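import Literature.AlgebraicGeometry.Resolution.LocalUniformizationAbhyankarPlaces
import Literature.AlgebraicGeometry.Resolution.HenselizationDefectless
import Literature.AlgebraicGeometry.Resolution.KnafKuhlmann2005Thm34Stability
import Literature.AlgebraicGeometry.Resolution.UnramifiedDefectlessGenerator
import Literature.AlgebraicGeometry.Resolution.ValuativeBasisRegular
import Literature.AlgebraicGeometry.Resolution.CentreLocalRingLemmas
import Literature.AlgebraicGeometry.Resolution.SmoothImpliesRegular
import Literature.AlgebraicGeometry.Resolution.RegularLocalRingsFlatDescent
import Literature.AlgebraicGeometry.Resolution.SubfieldTransport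
import Literature.AlgebraicGeometry.Resolution.SmoothUniformization
import Literature.AlgebraicGeometry.Resolution.SmoothAtTransport
import HarnessLib

/-!
# Cutkosky 2022, Thm. 1.3 (regular local uniformization at Abhyankar places): proofs

Topic: `Literature/AlgebraicGeometry/Resolution`. Sibling of
`LocalUniformizationAbhyankarPlaces.lean`; DISCHARGES the named fact
`Cutkosky2022_Thm13` (`Cutkosky2022_Thm13_holds`, end of this file) = S. D. Cutkosky, *Local uniformization of Abhyankar valuations*, Michigan
Math. J. 71 (2022) = arXiv:2003.06374, **Thm. 1.3** in the affine-model form vendored there: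
for a finitely generated `K/k`, a valuation ring `O ⊇ k` of `K` which is an Abhyankar place and
a finitely generated `S ⊆ O`, there is a finitely generated `A`, `S ≤ A ⊆ O`, `Frac A = K`,
`A` REGULAR at the centre — over an ARBITRARY ground field (no separability of the residue
field extension, in contrast with Knaf–Kuhlmann 2005, Thm. 1.1).

## The argument formalized

The printed proof (§§3–5 of the source: pseudo-valuations on completions, a Perron–Zariski
reduction algorithm, induction on the rank) is not followed. Instead the tree's valuation
theory gives a shorter road, all of whose deep inputs are PROVED in this topic:

1. an Abhyankar basis `(x, y)` of `K/k` with `|x|` a `ℤ`-basis of the value group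
   (`exists_adapted_isAbhyankarBasis`), `L := k(x, y)`;
2. the **generalized stability theorem** (`Kuhlmann2010Stability_holds`): `(L, V ∩ L)` is a
   defectless field; with `e(K|L) = 1` the **degree formula** of the henselization
   (`isDefectlessIn_adjoin_of_isDefectlessIn`, `HenselizationDefectless.lean`) gives
   `[L^h K : L^h] = f = [κ(K) : κ(L)]`, so `L^h K = ⊕ L^h αᵢ` for lifts `αᵢ ∈ O` of a residue
   basis, the `αᵢ` being VALUATION INDEPENDENT over `L^h` (`ValuativeBasisRegular.lean`);
3. the finitely many coefficients `c ∈ V ∩ L^h` of the expansions of generators, structure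
   constants, … generate a finite subextension `L'` of `L^h|L`, immediate, hence (stability
   again) generated by a **Hensel root** `η` (`exists_generator_valuation_derivative_eq_one`);
4. Knaf–Kuhlmann's **Thm. 4.1 / Lemma 5.1** (`knafKuhlmann2005_thm41_field`, the
   standard-étale model of `AbhyankarEtaleAscent.lean`) give a smooth local ring `D` of `L'`,
   standard-étale over a polynomial ring of `L`, containing the `c`'s;
5. `B' := ⊕ D αᵢ` is then a local ring with maximal ideal `𝔪_D B'`, hence REGULAR
   (`isRegularLocalRing_of_comap_maximalIdeal`, `ValuativeBasisRegular.lean`);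
6. **descent to `K`**: for the local ring `C` of a suitable affine model `N` of `K` (containing
   `S`, generators of `K`, the `αᵢ`, the Perron chart and the coefficients of the minimal
   polynomial `μ` of `η` over `K`, which lie in `B'` by normality of `B'` and
   `Polynomial.isIntegral_coeff_of_dvd`), `C[η] ≅ C[X]/(μ)` is free over `C` and `B'` is its
   localization at the centre, so `C → B'` is flat and local and `C` is regular by flat descent
   (`IsRegularLocalRing.of_flat_of_isLocalHom`, Matsumura 23.7 (i)).

Layout: `Immediate`, `HenselRoot` (step 3), `ValuationBasis` (step 2), `EtaleChart` (step 4),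
`ValuativeSpan` (step 5), `Descent` (step 6), `AbhyankarData` (step 1), `Main`
(`exists_regular_model_of_isAbhyankarPlace`: the statement inside an algebraically closed `Ω`),
`Transport` + `Typed` (`Cutkosky2022_Thm13_holds`: embed `K ↪ Ω = K̄`, extend `O` to `V`,
transport, pull back). No named facts are introduced; everything is PROVED.

## References

* S. D. Cutkosky, *Local uniformization of Abhyankar valuations*, Michigan Math. J. 71 (2022)
  = arXiv:2003.06374, Thm. 1.1, Thm. 1.3. [Cutkosky2022]
* H. Knaf, F.-V. Kuhlmann, *Abhyankar places admit local uniformization in any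
  characteristic*, Ann. Sci. ÉNS 38 (2005), Thm. 1.1, Thm. 4.1, Lemma 5.1. [KnafKuhlmann2005]
* F.-V. Kuhlmann, *Elimination of ramification I: The generalized stability theorem*, Trans.
  AMS 362 (2010), Thm. 1.1, Lemma 2.2, Thm. 2.14. [Kuhlmann2010]
* H. Matsumura, *Commutative ring theory*, CUP 1986 (paperback 1989), Thm. 23.7. [Matsumura1987]
-/

noncomputable section

namespace Literature.AlgebraicGeometry.Resolution

open IsLocalRing ValuationSubring Polynomial
open scoped IntermediateField

universe u

/-! ## Immediate extensions: `e = 1`, `κ = κ` in the typed rendering -/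

section Immediate

variable {Ω : Type u} [Field Ω] (V : ValuationSubring Ω)
variable {E' F' : Type u} [Field E'] [Field F'] [Algebra E' F'] [Algebra F' Ω] [Algebra E' Ω]
  [IsScalarTower E' F' Ω]

/-- If every value of `F'` (inside `(Ω, V)`) is the value of an element of `E'`, then
`|E'^×| = |F'^×|` (`valueSubgroup E' (V ∩ F') = ⊤`). [folklore] -/
theorem valueSubgroup_eq_top_of_forall_exists
    (hv : ∀ a : F', a ≠ 0 → ∃ c : E',
      V.valuation (algebraMap F' Ω a) = V.valuation (algebraMap E' Ω c)) :
    valueSubgroup E' (V.comap (algebraMap F' Ω)) = ⊤ := by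
  have h := ramificationIndex_eq_one_of_forall_exists V (E' := E') (F' := F') hv
  unfold ramificationIndex at h
  exact Subgroup.index_eq_one.mp h

/-- If every element of `V ∩ F'` is congruent modulo `𝔪(V)` to an element of `E'`, then the
residue fields agree (`residueSubfield E' (V ∩ F') = ⊤`). [folklore] -/
theorem residueSubfield_eq_top_of_forall_exists
    (hr : ∀ a : F', algebraMap F' Ω a ∈ V → ∃ c : E',
      V.valuation (algebraMap F' Ω a - algebraMap E' Ω c) < 1) :
    residueSubfield E' (V.comap (algebraMap F' Ω)) = ⊤ := by
  set O := V.comap (algebraMap F' Ω) with hO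
  refine eq_top_iff.mpr fun r _ => ?_
  obtain ⟨a, rfl⟩ := IsLocalRing.residue_surjective r
  obtain ⟨c, hc⟩ := hr a a.2
  rw [IsScalarTower.algebraMap_apply E' F' Ω c, ← map_sub] at hc
  have hlt : O.valuation ((a : F') - algebraMap E' F' c) < 1 :=
    (valuation_map_lt_one_iff (algebraMap F' Ω) (V := O) (V' := V) rfl _).mp hc
  have hcO : algebraMap E' F' c ∈ O := by
    have h1 : algebraMap E' F' c = (a : F') - ((a : F') - algebraMap E' F' c) := by ring
    rw [← O.valuation_le_one_iff, h1]
    refine (O.valuation.map_sub _ _).trans (max_le ?_ hlt.le)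
    exact (O.valuation_le_one_iff _).mpr a.2
  have heq : IsLocalRing.residue O a = IsLocalRing.residue O ⟨algebraMap E' F' c, hcO⟩ := by
    rw [← sub_eq_zero, ← map_sub, IsLocalRing.residue_eq_zero_iff,
      ValuationSubring.valuation_lt_one_iff]
    exact hlt
  rw [heq]
  exact residue_mem_residueSubfield E' O c hcO

end Immediate

/-! ## A finite subextension of the henselization of a defectless field has a Hensel root -/

section HenselRoot

variable {Ω : Type u} [Field Ω] [IsAlgClosed Ω] (V : ValuationSubring Ω) (L : Subfield Ω)

/-- **Hensel-root generators inside the henselization of a defectless field.** Let `(L, V ∩ L)`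
be a defectless valued field (`Ω` algebraically closed, `L^h ⊆ Ω` its henselization) and `C` a
finite subset of `L^h`. Then there is `η ∈ V ∩ L^h` with `C ⊆ L(η)` which is a root of a monic
polynomial `f` over `V ∩ L`, of least degree among the non-zero polynomials over `L` vanishing at
`η`, with `v(f'(η)) = 1`. Indeed `L' := L(C) ⊆ L^h` is a finite IMMEDIATE extension of `L`
(Kuhlmann 2010, Lemma 2.2, `Kuhlmann2010HenselizationImmediate_holds`): `e = 1` and the residue
fields agree, so the valuation theory of unramified defectless extensions
(`exists_generator_valuation_derivative_eq_one`) applies. [cite: Kuhlmann2010, Lemma 2.2] -/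
theorem exists_henselRoot_of_subset_henselization
    (hdef : IsDefectlessField L (V.comap (algebraMap L Ω)))
    (C : Finset Ω) (hC : ∀ c ∈ C, c ∈ henselization V L) :
    ∃ η : Ω, η ∈ V ∧ η ∈ henselization V L ∧
      (∀ c ∈ C, c ∈ Subfield.closure ((L : Set Ω) ∪ {η})) ∧
      ∃ f : Polynomial Ω, f.Monic ∧ (∀ i, f.coeff i ∈ V ∧ f.coeff i ∈ L) ∧ f.eval η = 0 ∧
        (∀ q : Polynomial Ω, (∀ i, q.coeff i ∈ L) → q ≠ 0 → q.eval η = 0 →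
          f.natDegree ≤ q.natDegree) ∧
        V.valuation ((derivative f).eval η) = 1 := by
  classical
  set Lh := henselization V L with hLh
  obtain ⟨hval, hres⟩ := Kuhlmann2010HenselizationImmediate_holds Ω V L
  set L' : IntermediateField L Ω := IntermediateField.adjoin L (C : Set Ω) with hL'
  have hL'h : ∀ z : Ω, z ∈ L' → z ∈ Lh := by
    intro z hz
    have hle : L'.toSubfield ≤ Lh := by
      rw [hL', IntermediateField.adjoin_toSubfield]
      refine Subfield.closure_le.mpr ?_
      rintro w (⟨c, rfl⟩ | hw)
      · exact le_henselization V L c.2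
      · exact hC w hw
    exact hle hz
  haveI : FiniteDimensional L L' :=
    IntermediateField.finiteDimensional_adjoin fun c hc =>
      (isSeparable_of_mem_henselization V L (hC c hc)).isIntegral
  set O' := V.comap (algebraMap L' Ω) with hO'
  -- `(L, V ∩ L)` is defectless, `e(L'|L) = 1`, residue fields agree
  have hdef' : IsDefectlessField L (O'.comap (algebraMap L L')) := by
    rwa [hO', ValuationSubring.comap_comap, ← IsScalarTower.algebraMap_eq]
  have hE : valueSubgroup L O' = ⊤ := by
    refine valueSubgroup_eq_top_of_forall_exists V fun a ha0 => ?_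
    have ha0' : (a : Ω) ≠ 0 := fun h => ha0 (Subtype.ext h)
    obtain ⟨b, hbL, hb⟩ := hval (a : Ω) (hL'h _ a.2) ha0'
    exact ⟨⟨b, hbL⟩, hb⟩
  have hsep : ∀ r : ResidueField O', IsSeparable (residueSubfield L O') r := by
    have htop : residueSubfield L O' = ⊤ := by
      refine residueSubfield_eq_top_of_forall_exists V fun a haV => ?_
      have hr : residue V ⟨(a : Ω), haV⟩ ∈ resField V L :=
        hres (residue_mem_resField V ⟨(a : Ω), haV⟩ (hL'h _ a.2))
      obtain ⟨a', ha'L, ha'⟩ := (mem_resField_iff V L _).mp hr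
      refine ⟨⟨(a' : Ω), ha'L⟩, ?_⟩
      have hsub : residue V (⟨(a : Ω), haV⟩ - a') = 0 := by rw [map_sub, ← ha', sub_self]
      rw [residue_eq_zero_iff, ValuationSubring.valuation_lt_one_iff] at hsub
      exact hsub
    intro r
    have hr : r ∈ residueSubfield L O' := by rw [htop]; trivial
    have : r = algebraMap (residueSubfield L O') (ResidueField O') ⟨r, hr⟩ := rfl
    rw [this]
    exact isSeparable_algebraMap _
  -- the generator
  obtain ⟨η, hηO, htop, hcoef, hder⟩ :=
    exists_generator_valuation_derivative_eq_one (F := L) O' hdef' hE hsep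
  have heval : ∀ p : Polynomial L', (p.map (algebraMap L' Ω)).eval (η : Ω) =
      algebraMap L' Ω (p.eval η) := fun p => by
    rw [Polynomial.eval_map]
    exact Polynomial.eval₂_hom (algebraMap L' Ω) η
  have hadj : IntermediateField.adjoin L {(η : Ω)} = L' := by
    have h1 : IntermediateField.lift (IntermediateField.adjoin L {η}) =
        IntermediateField.adjoin L {(η : Ω)} := by
      rw [IntermediateField.lift_adjoin, Set.image_singleton]
    rw [← h1, htop, IntermediateField.lift_top]
  refine ⟨(η : Ω), ValuationSubring.mem_comap.mp hηO, hL'h _ η.2, fun c hc => ?_,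
    ((minpoly L η).map (algebraMap L L')).map (algebraMap L' Ω), ?_, fun i => ?_, ?_, ?_, ?_⟩
  · -- `C ⊆ L(η)`
    rw [← mem_adjoin_subfield_iff, hadj]
    exact IntermediateField.subset_adjoin L _ hc
  · exact ((minpoly.monic (Algebra.IsIntegral.isIntegral η)).map _).map _
  · -- coefficients in `V ∩ L`
    rw [Polynomial.map_map, ← IsScalarTower.algebraMap_eq, Polynomial.coeff_map]
    exact ⟨ValuationSubring.mem_comap.mp (ValuationSubring.mem_comap.mp (hcoef i)),
      ((minpoly L η).coeff i).2⟩
  · -- `f(η) = 0`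
    rw [heval, Polynomial.eval_map, ← Polynomial.aeval_def, minpoly.aeval, map_zero]
  · -- least degree
    intro q hq hq0 hqη
    obtain ⟨Q, hQ, -⟩ := exists_polynomial_map_eq_of_coeff_mem_subfield L q hq
    have hQ0 : Q ≠ 0 := fun h => hq0 (by rw [← hQ, h, Polynomial.map_zero])
    have hQη : aeval η Q = 0 := by
      apply (algebraMap L' Ω).injective
      rw [map_zero, ← Polynomial.aeval_algebraMap_apply, Polynomial.aeval_def,
        ← Polynomial.eval_map, hQ]
      exact hqη
    rw [Polynomial.map_map, ← IsScalarTower.algebraMap_eq,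
      natDegree_map_eq_of_injective (algebraMap L Ω).injective, ← hQ,
      natDegree_map_eq_of_injective (algebraMap L Ω).injective]
    exact natDegree_le_of_dvd (minpoly.dvd L η hQη) hQ0
  · -- `v(f'(η)) = 1`
    rw [Polynomial.derivative_map, heval, Polynomial.derivative_map, Polynomial.eval_map,
      ← Polynomial.aeval_def]
    exact (valuation_comap_eq_one_iff V _).mp hder

end HenselRoot

/-! ## The valuation basis `α` of `L^h K` over `L^h` -/

section ValuationBasis

variable {Ω : Type u} [Field Ω] [IsAlgClosed Ω] (V : ValuationSubring Ω) (L : Subfield Ω)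
  (K : IntermediateField L Ω) [FiniteDimensional L K]

/-- **The valuation basis.** Let `(L, V ∩ L)` be a defectless valued field, `K ⊇ L` a finite
extension inside `Ω` with `e(V ∩ K | L) = 1` (every value of `K` is a value of `L`), and
`f = [κ(V ∩ K) : κ(V ∩ L)]`. Then there are `α₁, …, α_f ∈ V ∩ K` such that
(i) **valuation independence**: `v(c_j) ≤ v(∑ cᵢ αᵢ)` for all `cᵢ ∈ L^h` (lifts of a residue
basis, `ValuativeBasisRegular.lean`; the residue field of `L^h` is that of `L`, Kuhlmann 2010
Lemma 2.2), and (ii) **spanning**: every element of `K` is `∑ cᵢ αᵢ` with `cᵢ ∈ L^h` — because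
`[L^h K : L^h] = e·f = f` by the degree formula for the henselization of a defectless field
(Kuhlmann 2010, Thm. 2.14, `isDefectlessIn_adjoin_of_isDefectlessIn`), so that the `f`
independent `αᵢ` form an `L^h`-basis of `L^h K ⊇ K`. [cite: Kuhlmann2010, Lemma 2.2 and Thm. 2.14] -/
theorem exists_valuation_basis (hdef : IsDefectlessField L (V.comap (algebraMap L Ω)))
    (hE : valueSubgroup L (V.comap (algebraMap K Ω)) = ⊤) :
    ∃ (f : ℕ) (α : Fin f → Ω), 0 < f ∧ (∀ i, α i ∈ V ∧ α i ∈ K) ∧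
      (∀ c : Fin f → Ω, (∀ i, c i ∈ henselization V L) →
        ∀ j, V.valuation (c j) ≤ V.valuation (∑ i, c i * α i)) ∧
      (∀ z : Ω, z ∈ K → ∃ c : Fin f → Ω, (∀ i, c i ∈ henselization V L) ∧
        z = ∑ i, c i * α i) := by
  classical
  set Lh := henselization V L with hLh
  set O := V.comap (algebraMap K Ω) with hO
  obtain ⟨hval, hres⟩ := Kuhlmann2010HenselizationImmediate_holds Ω V L
  -- the residue basis and its lifts
  obtain ⟨-, hfin, -⟩ := ramificationIndex_mul_inertiaDegree_le_finrank L O (L := K)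
  haveI := hfin
  set f := inertiaDegree L O with hf
  let b : Module.Basis (Fin f) (residueSubfield L O) (ResidueField O) :=
    Module.finBasis (residueSubfield L O) (ResidueField O)
  choose αO hαO using fun i => IsLocalRing.residue_surjective (R := O) (b i)
  set α : Fin f → Ω := fun i => ((αO i : K) : Ω) with hα
  have hαV : ∀ i, α i ∈ V := fun i => ValuationSubring.mem_comap.mp (αO i).2
  have hαK : ∀ i, α i ∈ K := fun i => (αO i : K).2
  set αV : Fin f → V := fun i => ⟨α i, hαV i⟩ with hαVdef
  -- (a) the residues of the `αᵢ` in `κ(V)` are linearly independent over `resField V L`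
  let ψ := residueFieldHom K V
  have hψα : ∀ i, ψ (b i) = residue V (αV i) := fun i => by
    rw [← hαO i, residueFieldHom_residue]
    rfl
  have hψmem : ∀ r : residueSubfield L O, ψ r ∈ resField V L := by
    intro r
    obtain ⟨c, hc, hcr⟩ := (mem_residueSubfield_iff L O _).mp r.2
    rw [← hcr, residueFieldHom_residue]
    exact residue_mem_resField V _ c.2
  have hind : LinearIndependent (resField V L) fun i => residue V (αV i) := by
    have h := b.linearIndependent
    let σ : residueSubfield L O → resField V L := fun r => ⟨ψ r, hψmem r⟩
    have hσ : Function.Surjective σ := by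
      rintro ⟨t, ht⟩
      obtain ⟨a, haL, rfl⟩ := (mem_resField_iff V L t).mp ht
      have haO : algebraMap L K ⟨(a : Ω), haL⟩ ∈ O := ValuationSubring.mem_comap.mpr a.2
      refine ⟨⟨residue O ⟨_, haO⟩, residue_mem_residueSubfield L O _ haO⟩, Subtype.ext ?_⟩
      change ψ (residue O ⟨_, haO⟩) = residue V a
      rw [residueFieldHom_residue]
      rfl
    have h2 := h.map_of_surjective_injective σ ψ.toAddMonoidHom hσ
      (fun m hm => ψ.injective (by rw [map_zero]; exact hm))
      (fun r m => by
        change ψ (r • m) = (⟨ψ r, hψmem r⟩ : resField V L) • ψ m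
        rw [Algebra.smul_def, map_mul]
        rfl)
    have heq : (⇑ψ.toAddMonoidHom ∘ fun i => b i) = fun i => residue V (αV i) :=
      funext fun i => hψα i
    rwa [heq] at h2
  have hL : ∀ c : Ω, c ∈ Lh → (hc : c ∈ V) → residue V ⟨c, hc⟩ ∈ resField V L :=
    fun c hc hcV => hres (residue_mem_resField V ⟨c, hcV⟩ hc)
  have hindep : ∀ c : Fin f → Ω, (∀ i, c i ∈ Lh) →
      ∀ j, V.valuation (c j) ≤ V.valuation (∑ i, c i * α i) := fun c hc j =>
    valuation_le_valuation_sum_mul_of_linearIndependent_residue V Lh (resField V L) hL αV hind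
      c hc j
  -- (b) `[L^h K : L^h] = f`
  set ι : K →ₐ[L] Ω := K.val with hι
  set M : IntermediateField Lh Ω :=
    IntermediateField.adjoin Lh (Set.range (ι ∘ Module.finBasis L K)) with hM
  haveI : FiniteDimensional Lh M := finiteDimensional_adjoin_henselization V L _ ι
  have hιO : V.comap ι.toRingHom = O := rfl
  have hdefIn : IsDefectlessIn L (V.comap (algebraMap L Ω)) K := hdef K inferInstance
  have hfinrank : Module.finrank Lh M = f := by
    have h1 := isDefectlessIn_adjoin_of_isDefectlessIn V L
      Kuhlmann2010HenselizationImmediate_holds hdefIn ι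
    rw [isDefectlessIn_henselization_iff] at h1
    rw [← ramificationIndex_mul_inertiaDegree_comap_eq V L
      Kuhlmann2010HenselizationImmediate_holds ι M (algHom_apply_mem_adjoin V L _ ι)
      (adjoin_toSubfield_le_henselization V L _ ι)] at h1
    rw [hιO] at h1
    have he : ramificationIndex L O = 1 := by
      unfold ramificationIndex
      rw [hE, Subgroup.index_top]
    rw [he, one_mul] at h1
    exact h1.symm
  -- (c) the `αᵢ` form an `L^h`-basis of `M ⊇ K`
  have hαM : ∀ i, α i ∈ M := fun i => algHom_apply_mem_adjoin V L _ ι (αO i : K)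
  set αM : Fin f → M := fun i => ⟨α i, hαM i⟩ with hαMdef
  have hindΩ : LinearIndependent Lh fun i => (αV i : Ω) :=
    linearIndependent_of_linearIndependent_residue V Lh (resField V L) hL αV hind
  have hindM : LinearIndependent Lh αM := by
    refine LinearIndependent.of_comp M.val.toLinearMap ?_
    exact hindΩ
  have hspan : Submodule.span Lh (Set.range αM) = ⊤ :=
    hindM.span_eq_top_of_card_eq_finrank' (by rw [Fintype.card_fin, hfinrank])
  have hf0 : 0 < f := by
    rw [hf]
    unfold inertiaDegree
    exact Module.finrank_pos
  refine ⟨f, α, hf0, fun i => ⟨hαV i, hαK i⟩, hindep, fun z hz => ?_⟩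
  have hzM : (⟨z, algHom_apply_mem_adjoin V L _ ι ⟨z, hz⟩⟩ : M) ∈
      Submodule.span Lh (Set.range αM) := by rw [hspan]; trivial
  obtain ⟨c, hc⟩ := (Submodule.mem_span_range_iff_exists_fun Lh).mp hzM
  refine ⟨fun i => (c i : Ω), fun i => (c i).2, ?_⟩
  have h := congrArg (fun m : M => (m : Ω)) hc
  simp only at h
  rw [← h, AddSubmonoidClass.coe_finsetSum]
  refine Finset.sum_congr rfl fun i _ => ?_
  rw [IntermediateField.coe_smul, Algebra.smul_def]
  rfl

end ValuationBasis

/-! ## The standard-étale chart over a Perron chart of `L = k(x, y)` -/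

section EtaleChart

variable {Ω : Type u} [Field Ω] (V : ValuationSubring Ω) {K : Subfield Ω}

set_option maxHeartbeats 400000 in
/-- `exists_standardEtale_model` (Knaf–Kuhlmann 2005, Lemma 5.1) with the NORMAL FORM of the
elements of the model retained: every element of `A = B[η]_{g(η)}` is `q(η)/g(η)ⁿ` with `q` over
`B`. The proof is that of `AbhyankarEtaleAscent.exists_standardEtale_model`, verbatim.
[cite: KnafKuhlmann2005, Lemma 5.1 (proof, pp. 12–13)] -/
theorem exists_standardEtale_model_nf (B : Subalgebra K Ω) [Algebra.Smooth K B]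
    [IsIntegrallyClosed B] (hBV : B.toSubring ≤ V.toSubring) {F : Subfield Ω}
    (hBF : (B : Set Ω) ⊆ F) {η : Ω} (hηV : η ∈ V) (hηF : η ∈ F)
    (fB gB hB p₂B : Polynomial B) (s : ℕ) (hfBmon : fB.Monic) (hfBη : Polynomial.aeval η fB = 0)
    (hfBmin : ∀ q : Polynomial B, q ≠ 0 → Polynomial.aeval η q = 0 → fB.natDegree ≤ q.natDegree)
    (hidentB : Polynomial.derivative fB * hB + fB * p₂B = gB ^ s)
    (hvg : V.valuation (Polynomial.aeval η gB) = 1) :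
    ∃ (A : Subalgebra K Ω) (hAV : A.toSubring ≤ V.toSubring), (A : Set Ω) ⊆ F ∧
      Algebra.FinitePresentation K A ∧ Algebra.IsSmoothAt K (centre A V hAV) ∧
      (∀ q : Polynomial B, Polynomial.aeval η q ∈ A) ∧
      ∀ w ∈ A, ∃ (q : Polynomial B) (n : ℕ),
        w = Polynomial.aeval η q / Polynomial.aeval η gB ^ n := by
  classical
  have hgη0 : Polynomial.aeval η gB ≠ 0 := fun h0 => by
    rw [h0, map_zero] at hvg
    exact zero_ne_one hvg
  have hinj : Function.Injective (algebraMap B Ω) := Subtype.val_injective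
  -- `fB` is the minimal polynomial of `η` over `B`
  have hint : IsIntegral B η := ⟨fB, hfBmon, by rw [← Polynomial.aeval_def]; exact hfBη⟩
  have hmin : fB = minpoly B η := by
    refine minpoly.unique' B η hfBmon hfBη fun q hq => ?_
    by_cases hq0 : q = 0
    · exact Or.inl hq0
    · refine Or.inr fun hq' => ?_
      exact absurd (Polynomial.natDegree_lt_natDegree hq0 hq) (not_lt.mpr (hfBmin q hq0 hq'))
  -- `φ₀ : B[X]/(f) → Ω`, `X ↦ η`, is injective
  let φ₀ : AdjoinRoot fB →ₐ[B] Ω := AdjoinRoot.liftAlgHom fB (Algebra.ofId B Ω) η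
    (by rw [Algebra.toRingHom_ofId, ← Polynomial.aeval_def]; exact hfBη)
  have hφ₀mk : ∀ q : Polynomial B, φ₀ (AdjoinRoot.mk fB q) = Polynomial.aeval η q := fun q => by
    simp only [φ₀, AdjoinRoot.liftAlgHom_mk, Polynomial.aeval_def, Algebra.toRingHom_ofId]
  have hφ₀ : Function.Injective φ₀ := by
    rw [injective_iff_map_eq_zero]
    intro p hp
    obtain ⟨q, rfl⟩ := AdjoinRoot.mk_surjective p
    rw [hφ₀mk] at hp
    rw [AdjoinRoot.mk_eq_zero, hmin]
    exact minpoly.isIntegrallyClosed_dvd hint hp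
  -- the standard-étale algebra `L = (B[X]/(f))[1/g]` and `ψ : L → Ω`
  set r : AdjoinRoot fB := AdjoinRoot.mk fB gB with hr
  have hφ₀r : φ₀ r = Polynomial.aeval η gB := by rw [hr, hφ₀mk]
  have hrunit : IsUnit (φ₀ r) := by rw [hφ₀r]; exact isUnit_iff_ne_zero.mpr hgη0
  let L := Localization.Away r
  let ψ : L →ₐ[B] Ω := IsLocalization.Away.liftAlgHom r (f := φ₀) hrunit
  have hψalg : ∀ a : AdjoinRoot fB, ψ (algebraMap (AdjoinRoot fB) L a) = φ₀ a := fun a => by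
    simp only [ψ, IsLocalization.Away.coe_liftAlgHom, IsLocalization.Away.lift_eq]
    rfl
  have hnf : ∀ l : L, ∃ (q : Polynomial B) (n : ℕ),
      ψ l = Polynomial.aeval η q / Polynomial.aeval η gB ^ n := by
    intro l
    obtain ⟨⟨a, m⟩, hlm⟩ := IsLocalization.surj (Submonoid.powers r) l
    obtain ⟨n, hn⟩ := (Submonoid.mem_powers_iff _ _).mp m.2
    obtain ⟨q, rfl⟩ := AdjoinRoot.mk_surjective a
    refine ⟨q, n, ?_⟩
    have h1 : ψ l * Polynomial.aeval η gB ^ n = Polynomial.aeval η q := by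
      have := congrArg ψ hlm
      rw [map_mul, hψalg, hψalg, hφ₀mk] at this
      rw [← this, ← hn, map_pow, hφ₀r]
    rw [← h1, mul_div_assoc, div_self (pow_ne_zero n hgη0), mul_one]
  have hψ : Function.Injective ψ := by
    rw [injective_iff_map_eq_zero]
    intro l hl
    obtain ⟨⟨a, m⟩, hlm⟩ := IsLocalization.surj (Submonoid.powers r) l
    have h1 : φ₀ a = 0 := by
      have := congrArg ψ hlm
      rw [map_mul, hψalg, hψalg, hl, zero_mul] at this
      exact this.symm
    have ha : a = 0 := hφ₀ (by rw [h1, map_zero])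
    rw [ha, map_zero] at hlm
    exact (IsLocalization.map_units L m).mul_left_eq_zero.mp hlm
  -- `L` is standard étale over `B`, hence smooth over `K`; so is its image `A = ψ(L) ⊆ Ω`
  let SE : StandardEtalePair B :=
    { f := fB, monic_f := hfBmon, g := gB, cond := ⟨hB, p₂B, s, hidentB⟩ }
  haveI : Algebra.IsStandardEtale B L := Algebra.IsStandardEtale.of_equiv SE.equivAwayAdjoinRoot
  haveI : Algebra.Etale B L := inferInstance
  haveI hfsL : Algebra.FormallySmooth K L := Algebra.FormallySmooth.comp K B L
  haveI hfpL : Algebra.FinitePresentation K L := Algebra.FinitePresentation.trans K B L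
  let ψK : L →ₐ[K] Ω := ψ.restrictScalars K
  have hψK : Function.Injective ψK := hψ
  set A : Subalgebra K Ω := ψK.range with hA
  let eA : L ≃ₐ[K] A := AlgEquiv.ofInjective ψK hψK
  have hfpA : Algebra.FinitePresentation K A := Algebra.FinitePresentation.equiv eA
  haveI hfsA : Algebra.FormallySmooth K A := Algebra.FormallySmooth.of_equiv eA
  -- membership facts for `A`
  have hmemA : ∀ w : Ω, w ∈ A ↔ ∃ l, ψ l = w := fun w => AlgHom.mem_range ψK
  have hpolyA : ∀ q : Polynomial B, Polynomial.aeval η q ∈ A := fun q =>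
    (hmemA _).mpr ⟨algebraMap _ L (AdjoinRoot.mk fB q), by rw [hψalg, hφ₀mk]⟩
  have hnumV : ∀ q : Polynomial B, Polynomial.aeval η q ∈ V := fun q => by
    rw [aeval_eq_eval_map]
    exact eval_mem_of_coeff_mem V _
      (fun k => by rw [Polynomial.coeff_map]; exact hBV (q.coeff k).2) hηV
  have hnumF : ∀ q : Polynomial B, Polynomial.aeval η q ∈ F := fun q => by
    rw [aeval_eq_eval_map]
    exact eval_mem_of_coeff_mem F _
      (fun k => by rw [Polynomial.coeff_map]; exact hBF (q.coeff k).2) hηF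
  have hgpowV : ∀ n : ℕ, (Polynomial.aeval η gB ^ n)⁻¹ ∈ V := fun n =>
    (V.valuation_le_one_iff _).mp (by rw [map_inv₀, map_pow, hvg, one_pow, inv_one])
  have hAV : A.toSubring ≤ V.toSubring := by
    intro w hw
    obtain ⟨l, rfl⟩ := (hmemA w).mp hw
    obtain ⟨q, n, hq⟩ := hnf l
    rw [hq, div_eq_mul_inv]
    exact mul_mem (hnumV q) (hgpowV n)
  have hAF : (A : Set Ω) ⊆ F := by
    intro w hw
    obtain ⟨l, rfl⟩ := (hmemA w).mp hw
    obtain ⟨q, n, hq⟩ := hnf l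
    rw [hq]
    exact div_mem (hnumF q) (pow_mem (hnumF gB) n)
  refine ⟨A, hAV, hAF, hfpA, isSmoothAt_of_formallySmooth _, hpolyA, fun w hw => ?_⟩
  obtain ⟨l, rfl⟩ := (hmemA w).mp hw
  exact hnf l

/-- **The standard-étale chart** (Knaf–Kuhlmann 2005, Thm. 4.1 with Lemma 5.1, for a
`K`-trivial place): let `E = K(x, y)` with `x` of `ℤ`-independent values and `y ∈ O` of
residually algebraically independent residues, `η ∈ O` a root of a monic `f` over `O ∩ E` of
least degree over `E` with `v(f'(η)) = 1` (a Hensel root), and `C ⊆ O ∩ E(η)` finite. Then there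
are a finite set `G ⊆ O ∩ E` (Laurent monomials `x'` in `x`, the `y`, and the inverse of one
element of value `1`: generators of the Perron chart `B = K[x', y][1/d]`) and a `K`-subalgebra
`A ⊆ O ∩ E(η)` (the standard-étale `B`-algebra `B[η]_{f'(η)}`), finitely presented and smooth at
its centre, containing `G` and `η`, such that every `c ∈ C` lies in the local ring of `A` at the
centre and every element of `A` is `q(η)/f'(η)ⁿ` with `q` over `K[G]` (so `A` lies in the local
ring at the centre of `K[G][η]`). PROVED from `knafKuhlmann2005_thm41_field`,
`exists_standardEtale_model_nf` and `exists_div_of_valuation_derivative_eq_one`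
(`O_{E(η)} = (O_E[η])_q`). [cite: KnafKuhlmann2005, Thm. 4.1 and Lemma 5.1] -/
theorem exists_etaleChart (hKV : ∀ c ∈ K, c ∈ V) {ρ τ : ℕ} (x : Fin ρ → Ω) (y : Fin τ → Ω)
    (hx0 : ∀ i, x i ≠ 0)
    (hxi : ∀ m : Fin ρ → ℤ, (∃ b ∈ K, (∏ i, V.valuation (x i) ^ (m i)) = V.valuation b) → m = 0)
    (hy : ∀ j, y j ∈ V)
    (hri : AlgebraicIndependent (resField V K) (fun j => residue V ⟨y j, hy j⟩))
    {η : Ω} (hηV : η ∈ V) {f : Polynomial Ω} (hfmon : f.Monic)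
    (hcoef : ∀ i, f.coeff i ∈ V ∧
      f.coeff i ∈ Subfield.closure ((K : Set Ω) ∪ (Set.range x ∪ Set.range y)))
    (hfη : f.eval η = 0)
    (hfmin : ∀ q : Polynomial Ω,
      (∀ i, q.coeff i ∈ Subfield.closure ((K : Set Ω) ∪ (Set.range x ∪ Set.range y))) →
      q ≠ 0 → q.eval η = 0 → f.natDegree ≤ q.natDegree)
    (hder : V.valuation ((derivative f).eval η) = 1) (C : Finset Ω)
    (hC : ∀ c ∈ C, c ∈ V ∧ c ∈ Subfield.closure
      ((Subfield.closure ((K : Set Ω) ∪ (Set.range x ∪ Set.range y)) : Set Ω) ∪ {η})) :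
    ∃ (G : Finset Ω) (A : Subalgebra K Ω) (hAV : A.toSubring ≤ V.toSubring),
      (∀ g ∈ G, g ∈ V ∧ g ∈ Subfield.closure ((K : Set Ω) ∪ (Set.range x ∪ Set.range y))) ∧
      (A : Set Ω) ⊆ Subfield.closure
        ((Subfield.closure ((K : Set Ω) ∪ (Set.range x ∪ Set.range y)) : Set Ω) ∪ {η}) ∧
      Algebra.FinitePresentation K A ∧ Algebra.IsSmoothAt K (centre A V hAV) ∧
      (∀ g ∈ G, g ∈ A) ∧ η ∈ A ∧
      (∀ c ∈ C, c ∈ centreLocalRing V A) ∧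
      A ≤ centreLocalRing V (Algebra.adjoin K ((G : Set Ω) ∪ {η})) ∧
      (∀ i, f.coeff i ∈ A) := by
  classical
  set E : Subfield Ω := Subfield.closure ((K : Set Ω) ∪ (Set.range x ∪ Set.range y)) with hE
  set F : Subfield Ω := Subfield.closure ((E : Set Ω) ∪ {η}) with hF
  have hKE : K ≤ E := fun c hc => Subfield.subset_closure (Or.inl hc)
  have hEF : E ≤ F := fun c hc => Subfield.subset_closure (Or.inl hc)
  have hηF : η ∈ F := Subfield.subset_closure (Or.inr rfl)
  have hder0 : (derivative f).eval η ≠ 0 := fun h0 => by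
    rw [h0, map_zero] at hder; exact zero_ne_one hder
  -- representations of the elements of `C`
  have hrepC : ∀ c : C, ∃ a b : Polynomial Ω, (∀ i, a.coeff i ∈ V ∧ a.coeff i ∈ E) ∧
      (∀ i, b.coeff i ∈ V ∧ b.coeff i ∈ E) ∧ V.valuation (b.eval η) = 1 ∧
      (c : Ω) = a.eval η / b.eval η := fun c =>
    exists_div_of_valuation_derivative_eq_one V E hcoef hfmon hfη hfmin hder (hC c c.2).2
      (hC c c.2).1
  choose ac bc hac hbc hvbc hceq using hrepC
  -- the finite set `Z''` of coefficients
  let Z'' : Finset Ω := f.coeffs ∪ Finset.univ.biUnion fun c : C => (ac c).coeffs ∪ (bc c).coeffs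
  have hcoeffs : ∀ P : Polynomial Ω, (∀ i, P.coeff i ∈ V ∧ P.coeff i ∈ E) →
      ∀ w ∈ P.coeffs, w ∈ V ∧ w ∈ E := by
    intro P hP w hw
    obtain ⟨i, -, rfl⟩ := Polynomial.mem_coeffs_iff.mp hw
    exact hP i
  have hfZ : f.coeffs ⊆ Z'' := fun w hw => by simp [Z'', hw]
  have haZ : ∀ c : C, (ac c).coeffs ⊆ Z'' := fun c w hw => by
    simp only [Z'', Finset.mem_union, Finset.mem_biUnion, Finset.mem_univ, true_and]
    exact Or.inr ⟨c, Or.inl hw⟩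
  have hbZ : ∀ c : C, (bc c).coeffs ⊆ Z'' := fun c w hw => by
    simp only [Z'', Finset.mem_union, Finset.mem_biUnion, Finset.mem_univ, true_and]
    exact Or.inr ⟨c, Or.inr hw⟩
  have hZ'' : ∀ w ∈ Z'', w ∈ V ∧ w ∈ E := by
    intro w hw
    simp only [Z'', Finset.mem_union, Finset.mem_biUnion, Finset.mem_univ, true_and] at hw
    rcases hw with hw | ⟨c, hw | hw⟩
    · exact hcoeffs f hcoef w hw
    · exact hcoeffs _ (hac c) w hw
    · exact hcoeffs _ (hbc c) w hw
  -- Thm. 4.1 for `E` and `Z''`: the polynomial ring `A₀ = K[x', y]`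
  obtain ⟨x', hx', hxx', -, hind, hZ''A⟩ :=
    knafKuhlmann2005_thm41_field V K hKV x y hx0 hxi hy hri Z'' hZ''
  set A₀ : Subalgebra K Ω := Algebra.adjoin K (Set.range x' ∪ Set.range y) with hA₀
  let VK : Subalgebra K Ω := { V.toSubring with algebraMap_mem' := fun c => hKV c c.2 }
  have hA₀V' : A₀ ≤ VK := by
    refine Algebra.adjoin_le ?_
    rintro w (⟨j, rfl⟩ | ⟨j, rfl⟩)
    · exact (V.valuation_le_one_iff _).mp (hx' j).2.2.le
    · exact hy j
  have hA₀V : A₀.toSubring ≤ V.toSubring := fun w hw => hA₀V' hw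
  let EK : Subalgebra K Ω := { E.toSubring with algebraMap_mem' := fun c => hKE c.2 }
  have hA₀E' : A₀ ≤ EK := by
    refine Algebra.adjoin_le ?_
    rintro w (⟨j, rfl⟩ | ⟨j, rfl⟩)
    · exact (hx' j).1
    · exact Subfield.subset_closure (Or.inr (Or.inr ⟨j, rfl⟩))
  have hA₀E : (A₀ : Set Ω) ⊆ E := fun w hw => hA₀E' hw
  have hrange : Set.range (Sum.elim x' y) = Set.range x' ∪ Set.range y := Set.Sum.elim_range _ _
  let e₀ : MvPolynomial (Fin ρ ⊕ Fin τ) K ≃ₐ[K] A₀ :=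
    hind.aevalEquiv.trans (Subalgebra.equivOfEq _ _ (by rw [hA₀, ← hrange]))
  haveI : Algebra.FinitePresentation K A₀ := Algebra.FinitePresentation.equiv e₀
  haveI : Algebra.FormallySmooth K A₀ := Algebra.FormallySmooth.of_equiv e₀
  haveI : IsIntegrallyClosed A₀ := by
    haveI : UniqueFactorizationMonoid A₀ :=
      (e₀.toMulEquiv).uniqueFactorizationMonoid inferInstance
    infer_instance
  -- `B := A₀[1/d] ∋ Z''` (as in `exists_smooth_normal_locAway`, with `d` kept explicit)
  choose num hnum den hden hvden hweq using hZ''A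
  let d : Ω := ∏ w ∈ Z''.attach, den w w.2
  have hdA : d ∈ A₀ := prod_mem fun w _ => hden w w.2
  have hvd : V.valuation d = 1 := by
    simp only [d, map_prod]
    exact Finset.prod_eq_one fun w _ => hvden w w.2
  have hd0 : d ≠ 0 := fun h0 => by
    rw [h0, map_zero] at hvd
    exact zero_ne_one hvd
  set B : Subalgebra K Ω := locAway A₀ d hdA with hBdef
  have hA₀B : A₀ ≤ B := le_locAway
  have hZ''B : ∀ w ∈ Z'', w ∈ B := by
    intro w hw
    have hden0 : den w hw ≠ 0 := fun h0 => by
      have := hvden w hw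
      rw [h0, map_zero] at this
      exact zero_ne_one this
    have hsplit : d = den w hw * ∏ w' ∈ (Z''.attach.erase ⟨w, hw⟩), den w' w'.2 :=
      (Finset.mul_prod_erase Z''.attach (fun w' : {w' // w' ∈ Z''} => den w' w'.2)
        (Finset.mem_attach _ ⟨w, hw⟩)).symm
    have hwden : w * den w hw = num w hw := (eq_div_iff hden0).mp (hweq w hw)
    refine ⟨1, ?_⟩
    rw [pow_one, hsplit, ← mul_assoc, hwden]
    exact mul_mem (hnum w hw) (prod_mem fun w' _ => hden w' w'.2)
  letI algB : Algebra A₀ B := (Subalgebra.inclusion hA₀B).toRingHom.toAlgebra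
  haveI : IsScalarTower K A₀ B := IsScalarTower.of_algebraMap_eq fun _ => rfl
  haveI hloc : IsLocalization.Away (⟨d, hdA⟩ : A₀) B := isLocalization_locAway hd0
  haveI : Algebra.Smooth K A₀ := {}
  haveI hBsm : Algebra.Smooth K B := by
    haveI : Algebra.Smooth A₀ B := Algebra.Smooth.of_isLocalization_Away (⟨d, hdA⟩ : A₀)
    exact Algebra.Smooth.comp K A₀ B
  haveI hBic : IsIntegrallyClosed B :=
    isIntegrallyClosed_of_isLocalization B (Submonoid.powers (⟨d, hdA⟩ : A₀))
      (powers_le_nonZeroDivisors_of_noZeroDivisors fun h0 => hd0 (congrArg Subtype.val h0))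
  have hBV : B.toSubring ≤ V.toSubring := locAway_le_valuationSubring hA₀V hvd
  have hBE : (B : Set Ω) ⊆ E := locAway_subset_subfield hA₀E hd0
  have hBF : (B : Set Ω) ⊆ F := fun w hw => hEF (hBE hw)
  have hinj : Function.Injective (algebraMap B Ω) := Subtype.val_injective
  -- the generators `G = x' ∪ y ∪ {d⁻¹}` of `B`
  let G : Finset Ω := (Finset.univ.image x' ∪ Finset.univ.image y) ∪ {d⁻¹}
  have hdinvB : d⁻¹ ∈ B := inv_mem_locAway hd0
  have hGB : ∀ g ∈ G, g ∈ B := by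
    intro g hg
    simp only [G, Finset.mem_union, Finset.mem_image, Finset.mem_univ, true_and,
      Finset.mem_singleton] at hg
    rcases hg with (⟨j, rfl⟩ | ⟨j, rfl⟩) | rfl
    · exact hA₀B (Algebra.subset_adjoin (Or.inl ⟨j, rfl⟩))
    · exact hA₀B (Algebra.subset_adjoin (Or.inr ⟨j, rfl⟩))
    · exact hdinvB
  have hBG : B ≤ Algebra.adjoin K (G : Set Ω) := by
    intro w hw
    obtain ⟨b, hb, n, rfl⟩ := (mem_locAway_iff_exists_div hd0).mp hw
    have hA₀G : A₀ ≤ Algebra.adjoin K (G : Set Ω) := by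
      refine Algebra.adjoin_le ?_
      rintro u (⟨j, rfl⟩ | ⟨j, rfl⟩)
      · exact Algebra.subset_adjoin (by simp [G])
      · exact Algebra.subset_adjoin (by simp [G])
    rw [div_eq_mul_inv, ← inv_pow]
    exact mul_mem (hA₀G hb) (pow_mem (Algebra.subset_adjoin (by simp [G])) n)
  -- the polynomials over `B`
  have hcoefB : ∀ P : Polynomial Ω, P.coeffs ⊆ Z'' → ∀ i, P.coeff i ∈ B := by
    intro P hP i
    by_cases h0 : P.coeff i = 0
    · rw [h0]; exact B.zero_mem
    · exact hZ''B _ (hP (Polynomial.coeff_mem_coeffs h0))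
  obtain ⟨fB, hfB, hfBmon'⟩ := exists_map_eq_of_coeff_mem B f (hcoefB f hfZ)
  have hfBmon : fB.Monic := hfBmon' hfmon
  have hfBη : Polynomial.aeval η fB = 0 := by rw [aeval_eq_eval_map, hfB]; exact hfη
  have hgBη : Polynomial.aeval η (derivative fB) = (derivative f).eval η := by
    rw [aeval_eq_eval_map, ← Polynomial.derivative_map, hfB]
  have hvgB : V.valuation (Polynomial.aeval η (derivative fB)) = 1 := by rw [hgBη]; exact hder
  have hidentB : derivative fB * 1 + fB * 0 = (derivative fB) ^ 1 := by ring
  have hfBmin : ∀ q : Polynomial B, q ≠ 0 → Polynomial.aeval η q = 0 →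
      fB.natDegree ≤ q.natDegree := by
    intro q hq0 hq'
    have hqE : ∀ i, (q.map (algebraMap B Ω)).coeff i ∈ E := fun i => by
      rw [Polynomial.coeff_map]
      exact hBE (q.coeff i).2
    have hq'0 : q.map (algebraMap B Ω) ≠ 0 := (Polynomial.map_ne_zero_iff hinj).mpr hq0
    have hev : (q.map (algebraMap B Ω)).eval η = 0 := by rw [← aeval_eq_eval_map]; exact hq'
    have h1 := hfmin _ hqE hq'0 hev
    rwa [Polynomial.natDegree_map_eq_of_injective hinj, ← hfB,
      Polynomial.natDegree_map_eq_of_injective hinj] at h1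
  -- the standard-étale model
  obtain ⟨A, hAV, hAF, hfpA, hsmA, hpolyA, hnfA⟩ := exists_standardEtale_model_nf V B hBV hBF
    hηV hηF fB (derivative fB) 1 0 1 hfBmon hfBη hfBmin hidentB hvgB
  have hBA : ∀ b : Ω, b ∈ B → b ∈ A := fun b hb => by
    have := hpolyA (Polynomial.C ⟨b, hb⟩)
    rwa [Polynomial.aeval_C] at this
  have hηA : η ∈ A := by
    have := hpolyA Polynomial.X
    rwa [Polynomial.aeval_X] at this
  -- `K[G][η]`
  set N : Subalgebra K Ω := Algebra.adjoin K ((G : Set Ω) ∪ {η}) with hN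
  have hBN : B ≤ N := hBG.trans (Algebra.adjoin_mono Set.subset_union_left)
  have hηN : η ∈ N := Algebra.subset_adjoin (Or.inr rfl)
  have haevalN : ∀ q : Polynomial B, Polynomial.aeval η q ∈ N := fun q => by
    rw [aeval_eq_eval_map]
    exact eval_mem_of_coeff_mem N _ (fun i => by rw [Polynomial.coeff_map]; exact hBN (q.coeff i).2)
      hηN
  refine ⟨G, A, hAV, fun g hg => ⟨hBV (hGB g hg), hBE (hGB g hg)⟩, hAF, hfpA, hsmA,
    fun g hg => hBA g (hGB g hg), hηA, fun c hc => ?_, fun w hw => ?_,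
    fun i => hBA _ (hcoefB f hfZ i)⟩
  · -- `C ⊆ A_q`
    set γ : C := ⟨c, hc⟩ with hγ
    obtain ⟨aB, haB, -⟩ := exists_map_eq_of_coeff_mem B (ac γ) (hcoefB _ (haZ γ))
    obtain ⟨bB, hbB, -⟩ := exists_map_eq_of_coeff_mem B (bc γ) (hcoefB _ (hbZ γ))
    rw [show c = (γ : Ω) from rfl, hceq γ]
    refine div_mem_centreLocalRing ?_ ?_ (hvbc γ)
    · rw [← haB, ← aeval_eq_eval_map]
      exact hpolyA aB
    · rw [← hbB, ← aeval_eq_eval_map]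
      exact hpolyA bB
  · -- normal form: `A ⊆ K[G][η]_q`
    obtain ⟨q, n, rfl⟩ := hnfA w hw
    refine div_mem_centreLocalRing (haevalN q) (pow_mem (haevalN _) n) ?_
    rw [map_pow, hvgB, one_pow]

end EtaleChart

/-! ## The regular local ring `B' = ⊕ D αᵢ` -/

section ValuativeSpan

variable {Ω : Type u} [Field Ω] (V : ValuationSubring Ω) {k : Subfield Ω}

/-- **Units of a subalgebra of `O_V`**: in a `k`-subalgebra `D ⊆ V` in which the elements of
value `1` are invertible, an element is a unit iff its value is `1`. [folklore] -/
theorem isUnit_iff_valuation_eq_one_of_inv_mem {D : Subalgebra k Ω}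
    (hDV : D.toSubring ≤ V.toSubring) (hDloc : ∀ w ∈ D, V.valuation w = 1 → w⁻¹ ∈ D) (r : D) :
    IsUnit r ↔ V.valuation (r : Ω) = 1 := by
  constructor
  · rintro ⟨u, rfl⟩
    have h1 : V.valuation ((u : D) : Ω) * V.valuation ((↑u⁻¹ : D) : Ω) = 1 := by
      rw [← map_mul, ← Subalgebra.coe_mul, ← Units.val_mul, mul_inv_cancel, Units.val_one,
        Subalgebra.coe_one, map_one]
    have ha : V.valuation ((u : D) : Ω) ≤ 1 := (V.valuation_le_one_iff _).mpr (hDV (u : D).2)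
    have hb : V.valuation ((↑u⁻¹ : D) : Ω) ≤ 1 := (V.valuation_le_one_iff _).mpr (hDV (↑u⁻¹ : D).2)
    by_contra hne
    have hlt : V.valuation ((u : D) : Ω) < 1 := lt_of_le_of_ne ha hne
    have : V.valuation ((u : D) : Ω) * V.valuation ((↑u⁻¹ : D) : Ω) < 1 :=
      (mul_le_mul_right hb _).trans_lt (by rwa [mul_one])
    rw [h1] at this
    exact lt_irrefl _ this
  · intro h1
    have hr0 : (r : Ω) ≠ 0 := fun h0 => by rw [h0, map_zero] at h1; exact zero_ne_one h1
    refine isUnit_iff_exists_inv.mpr ⟨⟨(r : Ω)⁻¹, hDloc _ r.2 h1⟩, Subtype.ext ?_⟩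
    change (r : Ω) * (r : Ω)⁻¹ = 1
    exact mul_inv_cancel₀ hr0

/-- **The local ring `B' = ⊕ᵢ D αᵢ` is regular.** Let `D ⊆ O_V` be a `k`-subalgebra which is a
regular local ring whose units are its elements of value `1` (the local ring of a smooth
point), and `α₁, …, α_f ∈ O_V` with structure constants in `D` (`αᵢ αⱼ, 1 ∈ ∑ D α_l`) and
VALUATION INDEPENDENT over `D` (`v(c_j) ≤ v(∑ cᵢ αᵢ)`). Then `B' := {∑ cᵢ αᵢ : cᵢ ∈ D}` is a
`k`-subalgebra of `O_V`, finite free over `D`, and a REGULAR LOCAL RING whose units are its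
elements of value `1` (`isRegularLocalRing_of_comap_maximalIdeal`: its maximal ideal is
`𝔪_D B'`). [folklore] -/
theorem exists_regular_valuativeSpan {D : Subalgebra k Ω} (hDV : D.toSubring ≤ V.toSubring)
    (hD : IsRegularLocalRing D) (hDloc : ∀ w ∈ D, V.valuation w = 1 → w⁻¹ ∈ D)
    {f : ℕ} (α : Fin f → Ω) (hαV : ∀ i, α i ∈ V)
    (hmul : ∀ i j, ∃ c : Fin f → Ω, (∀ l, c l ∈ D) ∧ α i * α j = ∑ l, c l * α l)
    (hone : ∃ c : Fin f → Ω, (∀ l, c l ∈ D) ∧ (1 : Ω) = ∑ l, c l * α l)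
    (hind : ∀ c : Fin f → Ω, (∀ i, c i ∈ D) →
      ∀ j, V.valuation (c j) ≤ V.valuation (∑ i, c i * α i)) :
    ∃ B' : Subalgebra k Ω,
      (∀ w, w ∈ B' ↔ ∃ c : Fin f → Ω, (∀ i, c i ∈ D) ∧ w = ∑ i, c i * α i) ∧
      B'.toSubring ≤ V.toSubring ∧ D ≤ B' ∧ (∀ i, α i ∈ B') ∧
      IsRegularLocalRing B' ∧ (∀ w ∈ B', V.valuation w = 1 → w⁻¹ ∈ B') := by
  classical
  choose e he hemul using hmul
  obtain ⟨u, hu, hone⟩ := hone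
  -- the subalgebra
  let B' : Subalgebra k Ω :=
    { carrier := {w | ∃ c : Fin f → Ω, (∀ i, c i ∈ D) ∧ w = ∑ i, c i * α i}
      mul_mem' := by
        rintro _ _ ⟨c, hc, rfl⟩ ⟨c', hc', rfl⟩
        refine ⟨fun l => ∑ i, ∑ j, c i * c' j * e i j l,
          fun l => Subalgebra.sum_mem _ fun i _ => Subalgebra.sum_mem _ fun j _ =>
            D.mul_mem (D.mul_mem (hc i) (hc' j)) (he i j l), ?_⟩
        calc (∑ i, c i * α i) * ∑ j, c' j * α j
            = ∑ i, ∑ j, c i * c' j * (α i * α j) := by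
              rw [Finset.sum_mul_sum]
              refine Finset.sum_congr rfl fun i _ => Finset.sum_congr rfl fun j _ => by ring
          _ = ∑ i, ∑ j, c i * c' j * ∑ l, e i j l * α l := by
              refine Finset.sum_congr rfl fun i _ => Finset.sum_congr rfl fun j _ => by
                rw [hemul i j]
          _ = ∑ i, ∑ j, ∑ l, c i * c' j * (e i j l * α l) := by
              simp_rw [Finset.mul_sum]
          _ = ∑ i, ∑ l, ∑ j, c i * c' j * (e i j l * α l) :=
              Finset.sum_congr rfl fun i _ => Finset.sum_comm
          _ = ∑ l, ∑ i, ∑ j, c i * c' j * (e i j l * α l) := Finset.sum_comm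
          _ = ∑ l, (∑ i, ∑ j, c i * c' j * e i j l) * α l := by
              refine Finset.sum_congr rfl fun l _ => ?_
              rw [Finset.sum_mul]
              refine Finset.sum_congr rfl fun i _ => ?_
              rw [Finset.sum_mul]
              exact Finset.sum_congr rfl fun j _ => by ring
      one_mem' := ⟨u, hu, hone⟩
      add_mem' := by
        rintro _ _ ⟨c, hc, rfl⟩ ⟨c', hc', rfl⟩
        refine ⟨fun i => c i + c' i, fun i => D.add_mem (hc i) (hc' i), ?_⟩
        rw [← Finset.sum_add_distrib]
        exact Finset.sum_congr rfl fun i _ => by ring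
      zero_mem' := ⟨fun _ => 0, fun _ => D.zero_mem, by simp⟩
      algebraMap_mem' := fun a => by
        refine ⟨fun l => algebraMap k Ω a * u l, fun l => D.mul_mem (D.algebraMap_mem a) (hu l),
          ?_⟩
        calc algebraMap k Ω a = algebraMap k Ω a * 1 := (mul_one _).symm
          _ = algebraMap k Ω a * ∑ l, u l * α l := by rw [← hone]
          _ = ∑ l, algebraMap k Ω a * u l * α l := by
              rw [Finset.mul_sum]
              exact Finset.sum_congr rfl fun l _ => by ring }
  have hmemB' : ∀ w, w ∈ B' ↔ ∃ c : Fin f → Ω, (∀ i, c i ∈ D) ∧ w = ∑ i, c i * α i :=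
    fun w => Iff.rfl
  have hB'V : B'.toSubring ≤ V.toSubring := by
    rintro _ ⟨c, hc, rfl⟩
    exact V.toSubring.sum_mem fun i _ => V.toSubring.mul_mem (hDV (hc i)) (hαV i)
  have hDB' : D ≤ B' := fun w hw => by
    refine ⟨fun l => w * u l, fun l => D.mul_mem hw (hu l), ?_⟩
    calc w = w * 1 := (mul_one _).symm
      _ = w * ∑ l, u l * α l := by rw [← hone]
      _ = ∑ l, w * u l * α l := by
          rw [Finset.mul_sum]
          exact Finset.sum_congr rfl fun l _ => by ring
  have hαB' : ∀ i, α i ∈ B' := fun i => by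
    refine ⟨Pi.single i 1, fun l => ?_, ?_⟩
    · by_cases h : l = i
      · subst h; rw [Pi.single_eq_same]; exact D.one_mem
      · rw [Pi.single_eq_of_ne h]; exact D.zero_mem
    · rw [Finset.sum_eq_single i (fun l _ hl => by rw [Pi.single_eq_of_ne hl, zero_mul])
        (fun h => (h (Finset.mem_univ i)).elim), Pi.single_eq_same, one_mul]
  -- the data of `isRegularLocalRing_of_comap_maximalIdeal`
  letI : Algebra D B' := (Subalgebra.inclusion hDB').toRingHom.toAlgebra
  have halg : ∀ r : D, ((algebraMap D B' r : B') : Ω) = (r : Ω) := fun r => rfl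
  let g : B' →+* V :=
    { toFun := fun b => ⟨(b : Ω), hB'V b.2⟩
      map_one' := rfl
      map_mul' := fun _ _ => rfl
      map_zero' := rfl
      map_add' := fun _ _ => rfl }
  have hg : ∀ b : B', ((g b : V) : Ω) = (b : Ω) := fun b => rfl
  haveI : IsRegularLocalRing D := hD
  have hunitD : ∀ r : D, IsUnit r ↔ V.valuation (r : Ω) = 1 :=
    isUnit_iff_valuation_eq_one_of_inv_mem V hDV hDloc
  have hmaxV : ∀ b : B', g b ∈ maximalIdeal V ↔ V.valuation (b : Ω) < 1 := fun b =>
    ValuationSubring.valuation_lt_one_iff V (g b)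
  have hmaxD : ∀ r : D, r ∈ maximalIdeal D ↔ V.valuation (r : Ω) < 1 := fun r => by
    rw [IsLocalRing.mem_maximalIdeal, mem_nonunits_iff, hunitD]
    have hle : V.valuation (r : Ω) ≤ 1 := (V.valuation_le_one_iff _).mpr (hDV r.2)
    exact ⟨fun h => lt_of_le_of_ne hle h, fun h => h.ne⟩
  have hdom : ∀ r : D, g (algebraMap D B' r) ∈ maximalIdeal V ↔ r ∈ maximalIdeal D := fun r => by
    rw [hmaxV, hmaxD]
    rfl
  let αB : Fin f → B' := fun i => ⟨α i, hαB' i⟩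
  have hspan : Submodule.span D (Set.range αB) = ⊤ := by
    refine _root_.eq_top_iff.mpr fun w _ => ?_
    obtain ⟨c, hc, hw⟩ := (hmemB' w).mp w.2
    have hw' : w = ∑ i, (⟨c i, hc i⟩ : D) • αB i := by
      apply Subtype.ext
      rw [hw, AddSubmonoidClass.coe_finsetSum]
      refine Finset.sum_congr rfl fun i _ => ?_
      rw [Algebra.smul_def, Subalgebra.coe_mul]
      rfl
    rw [hw']
    exact Submodule.sum_mem _ fun i _ => Submodule.smul_mem _ _ (Submodule.subset_span ⟨i, rfl⟩)
  have hind' : ∀ c : Fin f → D, g (∑ i, algebraMap D B' (c i) * αB i) ∈ maximalIdeal V →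
      ∀ i, c i ∈ maximalIdeal D := by
    intro c hc i
    rw [hmaxV] at hc
    rw [hmaxD]
    have hsum : ((∑ i, algebraMap D B' (c i) * αB i : B') : Ω) = ∑ i, (c i : Ω) * α i := by
      rw [AddSubmonoidClass.coe_finsetSum]
      exact Finset.sum_congr rfl fun i _ => rfl
    rw [hsum] at hc
    exact (hind (fun i => (c i : Ω)) (fun i => (c i).2) i).trans_lt hc
  have hinj : Function.Injective (algebraMap D B') := fun a b h =>
    Subtype.ext (congrArg (fun t : B' => (t : Ω)) h)
  have hreg : IsRegularLocalRing B' :=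
    isRegularLocalRing_of_comap_maximalIdeal g hdom αB hspan hind' hD hinj
  refine ⟨B', hmemB', hB'V, hDB', hαB', hreg, fun w hw hw1 => ?_⟩
  -- units of `B'`
  letI := isLocalRing_of_comap_maximalIdeal g hdom αB hspan hind'
  have hmax := maximalIdeal_eq_comap_maximalIdeal g hdom αB hspan hind'
  have hwu : IsUnit (⟨w, hw⟩ : B') := by
    by_contra hnu
    have hm : (⟨w, hw⟩ : B') ∈ maximalIdeal B' := (IsLocalRing.mem_maximalIdeal _).mpr hnu
    rw [hmax, Ideal.mem_comap, hmaxV] at hm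
    exact hm.ne hw1
  obtain ⟨v, hv⟩ := hwu
  have hw0 : w ≠ 0 := fun h0 => by rw [h0, map_zero] at hw1; exact zero_ne_one hw1
  have hvinv : ((↑v⁻¹ : B') : Ω) = w⁻¹ := by
    apply eq_inv_of_mul_eq_one_left
    have h := congrArg (fun t : B' => (t : Ω)) v.inv_mul
    simp only [Subalgebra.coe_mul, Subalgebra.coe_one] at h
    rwa [hv] at h
  rw [← hvinv]
  exact (↑v⁻¹ : B').2

end ValuativeSpan

/-! ## Descent of regularity along `C → C[η]_q = B'` -/

section Descent

variable {Ω : Type u} [Field Ω] (V : ValuationSubring Ω) {k : Subfield Ω}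

/-- **Flat descent of regularity to the affine model of `K`.** Let `N ⊆ O_V` be a finitely
generated `k`-algebra with local ring `C = N_q` (`centreLocalRing V N`) at the centre, `η ∈ O_V`
a root of a monic polynomial `μ` over `N` such that no non-zero polynomial over `C` of smaller
degree vanishes at `η` (`μ` is the minimal polynomial of `η` over `Frac N`), and `B' ⊆ O_V` a
`k`-subalgebra which is a regular local ring with units its elements of value `1`, containing `N`
and `η` and contained in the local ring at the centre of `N[η]`. Then `B'` IS that local ring,
`C[η] ≅ C[X]/(μ)` is free over `C`, `B' = C[η]_q` is flat over `C` with `C → B'` local, and `C`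
is a regular local ring by flat descent (`IsRegularLocalRing.of_flat_of_isLocalHom`,
Matsumura 23.7 (i)). [cite: Matsumura1987, Thm. 23.7] -/
theorem isRegularLocalRing_centre_of_descent (N : Subalgebra k Ω) (hNfg : N.FG)
    (hNV : N.toSubring ≤ V.toSubring) {η : Ω} (hηV : η ∈ V) (μ : Polynomial Ω) (hμmon : μ.Monic)
    (hμcoef : ∀ i, μ.coeff i ∈ N) (hμη : μ.eval η = 0)
    (hμmin : ∀ q : Polynomial Ω, (∀ i, q.coeff i ∈ centreLocalRing V N) → q.eval η = 0 →
      q.natDegree < μ.natDegree → q = 0)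
    (B' : Subalgebra k Ω) (hreg : IsRegularLocalRing B') (hB'V : B'.toSubring ≤ V.toSubring)
    (hB'loc : ∀ w ∈ B', V.valuation w = 1 → w⁻¹ ∈ B') (hNB' : N ≤ B') (hηB' : η ∈ B')
    (hB'le : B' ≤ centreLocalRing V (Algebra.adjoin k ((N : Set Ω) ∪ {η}))) :
    IsRegularLocalRing (Localization.AtPrime (centre N V hNV)) := by
  classical
  set C : Subalgebra k Ω := centreLocalRing V N with hCdef
  have hCV : C.toSubring ≤ V.toSubring := centreLocalRing_le_valuationSubring hNV
  have hCloc : ∀ w ∈ C, V.valuation w = 1 → w⁻¹ ∈ C := fun w hw hw1 =>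
    inv_mem_centreLocalRing_of_valuation_eq_one hw hw1
  have hNC : N ≤ C := le_centreLocalRing N
  -- `C` is a Noetherian local ring (the localization of the finitely generated `N`)
  letI algNC : Algebra N C := (Subalgebra.inclusion hNC).toRingHom.toAlgebra
  haveI hlocN : IsLocalization.AtPrime C (centreIdeal N V hNV) := isLocalization_centreLocalRing N hNV
  haveI : IsLocalRing C := IsLocalization.AtPrime.isLocalRing C (centreIdeal N V hNV)
  haveI : IsNoetherianRing C := by
    haveI : Algebra.FiniteType k N := N.fg_iff_finiteType.mp hNfg
    haveI : IsNoetherianRing N := Algebra.FiniteType.isNoetherianRing k N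
    exact IsLocalization.isNoetherianRing (centreIdeal N V hNV).primeCompl C inferInstance
  -- `C ⊆ B'`, `C[η] ⊆ B'`
  have hCB' : C ≤ B' := by
    rintro _ ⟨a, ha, b, hb, hb1, rfl⟩
    rw [div_eq_mul_inv]
    exact B'.mul_mem (hNB' ha) (hB'loc b (hNB' hb) hb1)
  -- the polynomial `μ` over `C`, and `φ₀ : C[X]/(μ) → Ω`, `X ↦ η`
  let CK : Subalgebra k Ω := C
  have hμC : ∀ i, μ.coeff i ∈ C := fun i => hNC (hμcoef i)
  obtain ⟨μC, hμCmap, hμCmon'⟩ := exists_map_eq_of_coeff_mem C μ hμC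
  have hμCmon : μC.Monic := hμCmon' hμmon
  have hμCη : Polynomial.aeval η μC = 0 := by rw [aeval_eq_eval_map, hμCmap]; exact hμη
  have hinjC : Function.Injective (algebraMap C Ω) := Subtype.val_injective
  have hμC1 : μC ≠ 1 := fun h1 => by
    rw [h1, map_one] at hμCη
    exact one_ne_zero hμCη
  let φ₀ : AdjoinRoot μC →ₐ[C] Ω := AdjoinRoot.liftAlgHom μC (Algebra.ofId C Ω) η
    (by rw [Algebra.toRingHom_ofId, ← Polynomial.aeval_def]; exact hμCη)
  have hφ₀mk : ∀ q : Polynomial C, φ₀ (AdjoinRoot.mk μC q) = Polynomial.aeval η q := fun q => by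
    simp only [φ₀, AdjoinRoot.liftAlgHom_mk, Polynomial.aeval_def, Algebra.toRingHom_ofId]
  have hφ₀ : Function.Injective φ₀ := by
    rw [injective_iff_map_eq_zero]
    intro p hp
    obtain ⟨q, rfl⟩ := AdjoinRoot.mk_surjective p
    rw [hφ₀mk] at hp
    rw [AdjoinRoot.mk_eq_zero, ← Polynomial.modByMonic_eq_zero_iff_dvd hμCmon]
    set r := q %ₘ μC with hr
    have hrη : Polynomial.aeval η r = 0 := by
      rw [hr, Polynomial.aeval_modByMonic_eq_self_of_root hμCη]
      exact hp
    have hrdeg : r.natDegree < μC.natDegree := Polynomial.natDegree_modByMonic_lt q hμCmon hμC1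
    have hr0 : r.map (algebraMap C Ω) = 0 := by
      refine hμmin _ (fun i => ?_) ?_ ?_
      · rw [Polynomial.coeff_map]; exact (r.coeff i).2
      · rw [← aeval_eq_eval_map]; exact hrη
      · rw [Polynomial.natDegree_map_eq_of_injective hinjC, ← hμCmap,
          Polynomial.natDegree_map_eq_of_injective hinjC]
        exact hrdeg
    exact (Polynomial.map_eq_zero_iff hinjC).mp hr0
  -- `R₁ = C[η] ⊆ Ω` is free, hence flat, over `C`
  haveI : Module.Free C (AdjoinRoot μC) := Module.Free.of_basis (AdjoinRoot.powerBasis' hμCmon).basis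
  set R₁ : Subalgebra k Ω := (φ₀.restrictScalars k).range with hR₁def
  have hmemR₁ : ∀ w, w ∈ R₁ ↔ ∃ q : Polynomial C, Polynomial.aeval η q = w := by
    intro w
    rw [hR₁def, AlgHom.mem_range]
    constructor
    · rintro ⟨p, rfl⟩
      obtain ⟨q, rfl⟩ := AdjoinRoot.mk_surjective p
      exact ⟨q, (hφ₀mk q).symm⟩
    · rintro ⟨q, rfl⟩
      exact ⟨AdjoinRoot.mk μC q, hφ₀mk q⟩
  have hCR₁ : C ≤ R₁ := fun w hw => (hmemR₁ w).mpr ⟨Polynomial.C ⟨w, hw⟩, by rw [Polynomial.aeval_C]; rfl⟩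
  have hηR₁ : η ∈ R₁ := (hmemR₁ η).mpr ⟨Polynomial.X, by rw [Polynomial.aeval_X]⟩
  have hR₁B' : R₁ ≤ B' := by
    intro w hw
    obtain ⟨q, rfl⟩ := (hmemR₁ w).mp hw
    rw [aeval_eq_eval_map]
    exact eval_mem_of_coeff_mem B' _ (fun i => by rw [Polynomial.coeff_map]; exact hCB' (q.coeff i).2)
      hηB'
  have hR₁V : R₁.toSubring ≤ V.toSubring := fun w hw => hB'V (hR₁B' hw)
  -- `N₁ = k[N ∪ {η}] ⊆ R₁ ⊆ (N₁)_q`, so the local rings at the centre agree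
  set N₁ : Subalgebra k Ω := Algebra.adjoin k ((N : Set Ω) ∪ {η}) with hN₁def
  have hN₁R₁ : N₁ ≤ R₁ := by
    refine Algebra.adjoin_le ?_
    rintro w (hw | rfl)
    · exact hCR₁ (hNC hw)
    · exact hηR₁
  have hR₁N₁ : R₁ ≤ centreLocalRing V N₁ := by
    intro w hw
    obtain ⟨q, rfl⟩ := (hmemR₁ w).mp hw
    have hNN₁ : N ≤ N₁ := fun u hu => Algebra.subset_adjoin (Or.inl hu)
    have hCN₁ : C ≤ centreLocalRing V N₁ := centreLocalRing_mono hNN₁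
    have hηN₁ : η ∈ centreLocalRing V N₁ :=
      le_centreLocalRing N₁ (Algebra.subset_adjoin (Or.inr rfl))
    rw [aeval_eq_eval_map]
    exact eval_mem_of_coeff_mem (centreLocalRing V N₁) _
      (fun i => by rw [Polynomial.coeff_map]; exact hCN₁ (q.coeff i).2) hηN₁
  set B'' : Subalgebra k Ω := centreLocalRing V R₁ with hB''def
  have hB''eq : B'' = centreLocalRing V N₁ := centreLocalRing_eq_of_le_of_le hN₁R₁ hR₁N₁
  -- `B'' = B'`
  have hB'B'' : B' = B'' := by
    apply le_antisymm
    · rw [hB''eq]; exact hB'le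
    · rintro _ ⟨a, ha, b, hb, hb1, rfl⟩
      rw [div_eq_mul_inv]
      exact B'.mul_mem (hR₁B' ha) (hB'loc b (hR₁B' hb) hb1)
  haveI hregB'' : IsRegularLocalRing B'' :=
    @IsRegularLocalRing.of_ringEquiv B' _ hreg B'' _ (Subalgebra.equivOfEq B' B'' hB'B'').toRingEquiv
  -- flatness of `C → B''`
  letI algR₁B'' : Algebra R₁ B'' :=
    (Subalgebra.inclusion (le_centreLocalRing (O := V) R₁)).toRingHom.toAlgebra
  haveI hlocR₁ : IsLocalization.AtPrime B'' (centreIdeal R₁ V hR₁V) :=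
    isLocalization_centreLocalRing R₁ hR₁V
  haveI hflatR₁ : Module.Flat R₁ B'' := IsLocalization.flat B'' (centreIdeal R₁ V hR₁V).primeCompl
  have hCB'' : C ≤ B'' := hCR₁.trans (le_centreLocalRing R₁)
  letI algCB'' : Algebra C B'' := (Subalgebra.inclusion hCB'').toRingHom.toAlgebra
  letI algCR₁ : Algebra C R₁ := (Subalgebra.inclusion hCR₁).toRingHom.toAlgebra
  haveI : IsScalarTower C R₁ B'' := IsScalarTower.of_algebraMap_eq fun _ => rfl
  haveI : Module.Flat C R₁ := by
    -- `AdjoinRoot μC ≃ₗ[C] R₁` along `φ₀`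
    let l : AdjoinRoot μC →ₗ[C] R₁ :=
      { toFun := fun p => ⟨φ₀ p, ⟨p, rfl⟩⟩
        map_add' := fun p q => Subtype.ext (map_add φ₀ p q)
        map_smul' := fun c p => Subtype.ext (by
          change φ₀ (c • p) = ((algebraMap C R₁ c * ⟨φ₀ p, ⟨p, rfl⟩⟩ : R₁) : Ω)
          rw [map_smul, Algebra.smul_def]
          rfl) }
    have hl : Function.Bijective l := by
      refine ⟨fun p q h => hφ₀ (congrArg Subtype.val h), fun w => ?_⟩
      obtain ⟨p, hp⟩ := (AlgHom.mem_range _).mp w.2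
      exact ⟨p, Subtype.ext hp⟩
    exact Module.Flat.of_linearEquiv (LinearEquiv.ofBijective l hl).symm
  haveI : Module.Flat C B'' := Module.Flat.trans C R₁ B''
  -- `C → B''` is local
  have hB''V : B''.toSubring ≤ V.toSubring := centreLocalRing_le_valuationSubring hR₁V
  have hB''loc : ∀ w ∈ B'', V.valuation w = 1 → w⁻¹ ∈ B'' := fun w hw hw1 =>
    inv_mem_centreLocalRing_of_valuation_eq_one hw hw1
  haveI : IsLocalHom (algebraMap C B'') := by
    refine ⟨fun c hc => ?_⟩
    rw [isUnit_iff_valuation_eq_one_of_inv_mem V hB''V hB''loc] at hc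
    exact (isUnit_iff_valuation_eq_one_of_inv_mem V hCV hCloc c).mpr hc
  -- flat descent
  have hC : IsRegularLocalRing C := IsRegularLocalRing.of_flat_of_isLocalHom C B''
  exact (isRegularLocalRing_centre_iff N hNV).mpr hC

end Descent

/-! ## The Abhyankar data of `K|k` read in `Ω` -/

section AbhyankarData

variable {Ω : Type u} [Field Ω] (V : ValuationSubring Ω) (k K : Subfield Ω)

/-- **Adapted Abhyankar data, ambient form.** For `k ≤ K ⊆ Ω`, `K|k` finitely generated, `k ⊆ O_V`
and an Abhyankar place (`IsAbhyankarPlace V k K`), there are `x₁, …, x_ρ ∈ K^×` whose values are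
`ℤ`-independent and GENERATE the value group of `K` (every value of `K^×` is the value of an
element of `L := k(x, y)`), and `y₁, …, y_τ ∈ O_V ∩ K` with residues algebraically independent
over `kP`, such that `K` is algebraic over `L` and `(L, O_V ∩ L)` is a DEFECTLESS field — the
adapted Abhyankar basis of `AbhyankarBases.lean` (`exists_adapted_isAbhyankarBasis`, Temkin 2013
Thm. 5.5.1 (iii)) read back in `Ω`, and the generalized stability theorem
(`Kuhlmann2010Stability_holds`) for the Abhyankar valued function field `L|k`.
[cite: Kuhlmann2010, Thm. 1.1] -/
theorem exists_abhyankarData (hfg : FGOver k K) (hkV : (k : Set Ω) ⊆ V)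
    (hA : IsAbhyankarPlace V k K) :
    ∃ (ρ τ : ℕ) (x : Fin ρ → Ω) (y : Fin τ → Ω) (hy : ∀ j, y j ∈ V),
      (∀ i, x i ∈ K ∧ x i ≠ 0) ∧ (∀ j, y j ∈ K) ∧
      (∀ m : Fin ρ → ℤ, (∃ b ∈ k, (∏ i, V.valuation (x i) ^ (m i)) = V.valuation b) → m = 0) ∧
      AlgebraicIndependent (resField V k) (fun j => residue V ⟨y j, hy j⟩) ∧
      (∀ z ∈ K, IsAlgebraic (IntermediateField.adjoin k (Set.range x ∪ Set.range y)) z) ∧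
      IsDefectlessField (IntermediateField.adjoin k (Set.range x ∪ Set.range y))
        (V.comap (algebraMap (IntermediateField.adjoin k (Set.range x ∪ Set.range y)) Ω)) ∧
      (∀ z ∈ K, z ≠ 0 → ∃ w ∈ IntermediateField.adjoin k (Set.range x ∪ Set.range y),
        V.valuation z = V.valuation w) := by
  classical
  -- `K` as an intermediate field `M` of `Ω|k`, and `O := O_V ∩ M`
  obtain ⟨s₀, hs₀⟩ := hfg
  set M : IntermediateField k Ω := IntermediateField.adjoin k (s₀ : Set Ω) with hM
  have hMF : ∀ z : Ω, z ∈ M ↔ z ∈ K := fun z => by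
    rw [hM, mem_adjoin_subfield_iff, hs₀]
  have hfgM : (⊤ : IntermediateField k M).FG :=
    IntermediateField.fg_top_iff.mpr
      (IntermediateField.essFiniteType_iff.mpr (IntermediateField.fg_adjoin_finset s₀))
  have hk : ∀ c : k, algebraMap k M c ∈ V.comap (algebraMap M Ω) :=
    algebraMap_mem_comap_intermediateField V M hkV
  have hkV' : ∀ c : k, algebraMap k Ω c ∈ V := algebraMap_subfield_mem_of_subset V hkV
  set O := V.comap (algebraMap M Ω) with hO
  have hD : transcendenceDefect k O hk = 0 :=
    transcendenceDefect_comap_eq_zero_of_isAbhyankarPlace V M hMF hkV hfgM hA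
  letI := algebraOfMem k O hk
  letI := algebraOfMem k V hkV'
  -- a transcendence basis of the residue field as a finite set, and an adapted Abhyankar basis
  obtain ⟨E₁, F₁, x₁, y₁, hB₁⟩ := exists_isAbhyankarBasis O hk hfgM hD
  let g : Fin F₁ → ResidueField O := fun i => residue O (y₁ i)
  have hg : IsTranscendenceBasis k g := hB₁.isTranscendenceBasis_residue
  let s : Finset (ResidueField O) := Finset.univ.image g
  have hidx : ∀ w : s, ∃ i, g i = w := fun w => by
    obtain ⟨i, -, hi⟩ := Finset.mem_image.mp w.2
    exact ⟨i, hi⟩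
  choose idx hidx using hidx
  have hval : ((↑) : s → ResidueField O) = g ∘ idx := funext fun w => (hidx w).symm
  have hidxinj : Function.Injective idx := fun w w' h =>
    Subtype.ext (by rw [← hidx w, ← hidx w', h])
  have hsind : AlgebraicIndependent k ((↑) : s → ResidueField O) := by
    rw [hval]
    exact hg.1.comp idx hidxinj
  have hcoe : (s : Set (ResidueField O)) = Set.range g := by simp [s]
  have hs : IsTranscendenceBasis k ((↑) : s → ResidueField O) := by
    refine hsind.isTranscendenceBasis_iff_isAlgebraic.mpr ?_
    have key : ∀ S : Set (ResidueField O), S = Set.range g →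
        Algebra.IsAlgebraic (Algebra.adjoin k S) (ResidueField O) := by
      rintro S rfl
      exact hg.isAlgebraic
    exact key _ (by rw [Subtype.range_coe]; exact hcoe)
  obtain ⟨E, x, y, hB, hgen, -⟩ := exists_adapted_isAbhyankarBasis O hk hfgM hD s hs
  -- the data read in `Ω`
  set x' : Fin E → Ω := fun i => (x i : Ω) with hx'
  set y' : Fin s.card → Ω := fun j => ((y j : M) : Ω) with hy'
  have hy'V : ∀ j, y' j ∈ V := fun j => ValuationSubring.mem_comap.mp (y j).2
  have hx'0 : ∀ i, x' i ≠ 0 := fun i h =>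
    hB.ne_zero i ((map_eq_zero_iff _ (algebraMap M Ω).injective).mp h)
  have himg : Subtype.val '' Set.range (Sum.elim x fun i => (y i : M)) =
      Set.range x' ∪ Set.range y' := by
    rw [← Set.range_comp, Sum.comp_elim, Set.Sum.elim_range]
    rfl
  set L : IntermediateField k Ω := IntermediateField.adjoin k (Set.range x' ∪ Set.range y') with hL
  have hlift : IntermediateField.lift
      (IntermediateField.adjoin k (Set.range (Sum.elim x fun i => (y i : M)))) = L := by
    rw [IntermediateField.lift_adjoin, himg]
  -- (a) `ℤ`-independence of the values modulo `vk = 1`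
  have hvi : IsValueIndependent V x' :=
    (isValueIndependent_comap_iff V x).mp
      ((isValueIndependent_iff_linearIndependent O x hB.ne_zero).mpr hB.linearIndependent)
  have hxi : ∀ m : Fin E → ℤ,
      (∃ b ∈ k, (∏ i, V.valuation (x' i) ^ (m i)) = V.valuation b) → m = 0 := by
    rintro m ⟨b, hbK, hb⟩
    have hb0 : b ≠ 0 := by
      rintro rfl
      rw [map_zero] at hb
      exact (Finset.prod_ne_zero_iff.mpr fun i _ =>
        zpow_ne_zero _ (valuation_ne_zero_of_ne_zero V (hx'0 i))) hb
    have hb1 : V.valuation b = 1 :=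
      valuation_eq_one_of_subfield_subset V (F := k) (fun z hz => hkV hz) hbK hb0
    have hprod : V.valuation (∏ i ∈ Finset.univ, x' i ^ m i) = 1 := by
      rw [map_prod]
      simp_rw [map_zpow₀]
      rw [hb, hb1]
    funext i
    exact hvi.2 Finset.univ m hprod i (Finset.mem_univ i)
  -- (b) algebraic independence of the residues over `kP`
  have hri : AlgebraicIndependent (resField V k) (fun j => residue V ⟨y' j, hy'V j⟩) := by
    let ψ := residueFieldComapAlgHom k V hkV' hk
    have h1 : AlgebraicIndependent k fun i => residue O (y i) := hB.algebraicIndependent_residue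
    have h2 : AlgebraicIndependent k (⇑ψ ∘ fun i => residue O (y i)) :=
      h1.map ψ.toRingHom.injective.injOn
    have h3 : (⇑ψ ∘ fun i => residue O (y i)) = fun j => residue V ⟨y' j, hy'V j⟩ := by
      funext j
      simp only [Function.comp_apply]
      rw [residueFieldComapAlgHom_residue]
      rfl
    obtain ⟨φ, -, hφs, hφ, -⟩ := exists_residue_ringHoms V k (F := k) le_rfl (fun z hz => hkV hz)
    have hφcomp : (algebraMap (resField V k) (ResidueField V)).comp φ =
        (RingHom.id _).comp (algebraMap k (ResidueField V)) := RingHom.ext fun c => hφ c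
    have h4 := h2.ringHom_of_comp_eq φ (RingHom.id _) hφs (RingHom.id _).injective hφcomp
    rwa [RingHom.coe_id, Function.id_comp, h3] at h4
  -- (c) `K` is algebraic over `L`
  have halg : ∀ z ∈ K, IsAlgebraic L z := by
    intro z hz
    set AM : IntermediateField k M :=
      IntermediateField.adjoin k (Set.range (Sum.elim x fun i => (y i : M))) with hAM
    haveI : Algebra.IsAlgebraic AM M := hB.isTranscendenceBasis.isAlgebraic_field
    have h1 : IsAlgebraic AM (⟨z, (hMF z).mpr hz⟩ : M) := Algebra.IsAlgebraic.isAlgebraic _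
    let e : AM ≃ₐ[k] L :=
      (IntermediateField.liftAlgEquiv AM).trans (IntermediateField.equivOfEq hlift)
    exact h1.ringHom_of_comp_eq (f := (e : AM →+* L)) (g := algebraMap M Ω) e.injective
      (RingHom.ext fun _ => rfl)
  -- (d) `L` is a defectless field: `D_{L/k} = 0` and the generalized stability theorem
  have hLE : ∀ z, z ∈ L ↔ z ∈ Subfield.closure ((k : Set Ω) ∪ (Set.range x' ∪ Set.range y')) :=
    fun z => mem_adjoin_subfield_iff k _ z
  have hkL : ∀ c : k, algebraMap k L c ∈ V.comap (algebraMap L Ω) :=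
    algebraMap_mem_comap_intermediateField V L hkV
  have hfgL : (⊤ : IntermediateField k L).FG :=
    IntermediateField.fg_top_iff.mpr (IntermediateField.essFiniteType_iff.mpr
      (IntermediateField.fg_adjoin_of_finite ((Set.finite_range x').union (Set.finite_range y'))))
  have hAbhL : IsAbhyankarPlace V k
      (Subfield.closure ((k : Set Ω) ∪ (Set.range x' ∪ Set.range y'))) :=
    isAbhyankarPlace_closure hy'V hxi hri
  have hDL : transcendenceDefect k (V.comap (algebraMap L Ω)) hkL = 0 :=
    transcendenceDefect_comap_eq_zero_of_isAbhyankarPlace V L hLE hkV hfgL hAbhL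
  have hdef : IsDefectlessField L (V.comap (algebraMap L Ω)) :=
    Kuhlmann2010Stability_holds k L hfgL _ hkL hDL
  -- (e) every value of `K^×` is the value of an element of `L`
  have hvalK : ∀ z ∈ K, z ≠ 0 → ∃ w ∈ L, V.valuation z = V.valuation w := by
    intro z hz hz0
    set zM : M := ⟨z, (hMF z).mpr hz⟩ with hzM
    have hzM0 : zM ≠ 0 := fun h => hz0 (congrArg Subtype.val h)
    have hmem : Units.mk0 (O.valuation zM) (valuation_ne_zero_of_ne_zero O hzM0) ∈
        Subgroup.closure (Set.range fun j =>
          Units.mk0 (O.valuation (x j)) (valuation_ne_zero_of_ne_zero O (hB.ne_zero j))) := by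
      rw [hgen]; trivial
    -- the predicate: the value of an element of `L`
    have key : ∀ γ ∈ Subgroup.closure (Set.range fun j =>
          Units.mk0 (O.valuation (x j)) (valuation_ne_zero_of_ne_zero O (hB.ne_zero j))),
        ∃ w : M, (w : Ω) ∈ L ∧ w ≠ 0 ∧ Units.val γ = O.valuation w := by
      intro γ hγ
      refine Subgroup.closure_induction (p := fun (γ : (ValuationSubring.ValueGroup O)ˣ) _ =>
        ∃ w : M, (w : Ω) ∈ L ∧ w ≠ 0 ∧ Units.val γ = O.valuation w) ?_ ?_ ?_ ?_ hγ
      · rintro _ ⟨j, rfl⟩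
        exact ⟨x j, IntermediateField.subset_adjoin k _ (Or.inl ⟨j, rfl⟩), hB.ne_zero j, rfl⟩
      · exact ⟨1, L.one_mem, one_ne_zero, by rw [Units.val_one, map_one]⟩
      · rintro a b - - ⟨w, hwL, hw0, hw⟩ ⟨w', hw'L, hw'0, hw'⟩
        exact ⟨w * w', L.mul_mem hwL hw'L, mul_ne_zero hw0 hw'0,
          by rw [Units.val_mul, hw, hw', map_mul]⟩
      · rintro a - ⟨w, hwL, hw0, hw⟩
        exact ⟨w⁻¹, L.inv_mem hwL, inv_ne_zero hw0, by rw [Units.val_inv_eq_inv_val, hw, map_inv₀]⟩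
    obtain ⟨w, hwL, hw0, hw⟩ := key _ hmem
    rw [Units.val_mk0] at hw
    refine ⟨(w : Ω), hwL, ?_⟩
    exact (valuation_map_eq_iff (algebraMap M Ω) (V := O) (V' := V) rfl zM w).mpr hw
  exact ⟨E, s.card, x', y', hy'V, fun i => ⟨(hMF _).mp (x i).2, hx'0 i⟩,
    fun j => (hMF _).mp (y j : M).2, hxi, hri, halg, hdef, hvalK⟩

end AbhyankarData

/-! ## Two small helpers -/

section Helpers

variable {Ω : Type u} [Field Ω] (V : ValuationSubring Ω) (k K : Subfield Ω)

/-- Generators of a finitely generated extension `K|k` may be chosen in the valuation ring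
(replace a generator `t ∉ O_V` by `t⁻¹ ∈ O_V`). [folklore] -/
theorem exists_generators_mem_valuationSubring (s₀ : Finset Ω)
    (hs₀ : Subfield.closure ((k : Set Ω) ∪ s₀) = K) :
    ∃ s₁ : Finset Ω, (∀ t ∈ s₁, t ∈ V ∧ t ∈ K) ∧ Subfield.closure ((k : Set Ω) ∪ s₁) = K := by
  classical
  have hs₀K : ∀ t ∈ s₀, t ∈ K := fun t ht => by
    rw [← hs₀]; exact Subfield.subset_closure (Or.inr ht)
  have hkK : ∀ c ∈ k, c ∈ K := fun c hc => by
    rw [← hs₀]; exact Subfield.subset_closure (Or.inl hc)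
  refine ⟨s₀.image fun t => if t ∈ V then t else t⁻¹, fun t ht => ?_, le_antisymm ?_ ?_⟩
  · obtain ⟨t, ht0, rfl⟩ := Finset.mem_image.mp ht
    by_cases htV : t ∈ V
    · rw [if_pos htV]; exact ⟨htV, hs₀K t ht0⟩
    · rw [if_neg htV]
      exact ⟨(V.mem_or_inv_mem t).resolve_left htV, inv_mem (hs₀K t ht0)⟩
  · refine Subfield.closure_le.mpr ?_
    rintro t (ht | ht)
    · exact hkK t ht
    · obtain ⟨t, ht0, rfl⟩ := Finset.mem_image.mp ht
      by_cases htV : t ∈ V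
      · rw [if_pos htV]; exact hs₀K t ht0
      · rw [if_neg htV]; exact inv_mem (hs₀K t ht0)
  · rw [← hs₀]
    refine Subfield.closure_le.mpr ?_
    rintro t (ht | ht)
    · exact Subfield.subset_closure (Or.inl ht)
    · by_cases htV : t ∈ V
      · refine Subfield.subset_closure (Or.inr ?_)
        rw [Finset.coe_image]
        exact ⟨t, ht, by show (if t ∈ V then t else t⁻¹) = t; rw [if_pos htV]⟩
      · have hinv : t⁻¹ ∈ Subfield.closure ((k : Set Ω) ∪
            ↑(s₀.image fun t => if t ∈ V then t else t⁻¹)) := by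
          refine Subfield.subset_closure (Or.inr ?_)
          rw [Finset.coe_image]
          exact ⟨t, ht, by show (if t ∈ V then t else t⁻¹) = t⁻¹; rw [if_neg htV]⟩
        rw [← inv_inv t]
        exact inv_mem hinv

/-- **Integrally closed subalgebras contain the integral elements of their fraction field**
(inside `Ω`): if `R ⊆ Ω` is an integrally closed `k`-subalgebra and `w = a/b` with `a, b ∈ R`
is integral over `R`, then `w ∈ R`. [folklore] -/
theorem mem_of_isIntegral_of_eq_div (R : Subalgebra k Ω) [IsIntegrallyClosed R] {w a b : Ω}
    (ha : a ∈ R) (hb : b ∈ R) (hb0 : b ≠ 0) (hw : w = a / b) (hint : IsIntegral R w) :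
    w ∈ R := by
  let F := FractionRing R
  have hinj : Function.Injective (Algebra.ofId R Ω) := Subtype.val_injective
  let ι : F →ₐ[R] Ω := IsFractionRing.liftAlgHom hinj
  have hbnz : (⟨b, hb⟩ : R) ∈ nonZeroDivisors R :=
    mem_nonZeroDivisors_of_ne_zero fun h => hb0 (congrArg Subtype.val h)
  let z : F := IsLocalization.mk' F (⟨a, ha⟩ : R) ⟨⟨b, hb⟩, hbnz⟩
  have hιz : ι z = w := by
    change IsFractionRing.lift hinj _ = w
    rw [IsFractionRing.lift_mk', hw]
    rfl
  have hzint : IsIntegral R z := by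
    rw [← isIntegral_algHom_iff ι (ι : F →+* Ω).injective, hιz]
    exact hint
  obtain ⟨y, hy⟩ := IsIntegrallyClosed.isIntegral_iff.mp hzint
  have hwy : w = (y : Ω) := by
    rw [← hιz, ← hy, AlgHom.commutes]
    rfl
  rw [hwy]
  exact y.2

end Helpers

/-! ## Theorem 1.3 inside an algebraically closed field -/

section Main

variable {Ω : Type u} [Field Ω] [IsAlgClosed Ω] (V : ValuationSubring Ω) (k K : Subfield Ω)

/-- **Local uniformization of Abhyankar places in arbitrary characteristic, ambient form**
(Cutkosky 2022, Thm. 1.3; Knaf–Kuhlmann 2005, Thm. 1.1 without the separability hypotheses):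
for `k ≤ K ⊆ Ω` (`Ω` algebraically closed), `K|k` a finitely generated extension, `k ⊆ O_V` and
`IsAbhyankarPlace V k K`, and a finite `S ⊆ O_V ∩ K`, there is a finitely generated
`k`-subalgebra `A ⊆ O_V ∩ K` containing `S`, with `Frac A = K`, whose local ring at the centre
of `V` is a regular local ring. PROVED along the road described in the module docstring.
[cite: Cutkosky2022, Thm. 1.3] -/
theorem exists_regular_model_of_isAbhyankarPlace (hkK : k ≤ K) (hfg : FGOver k K)
    (hkV : (k : Set Ω) ⊆ V) (hA : IsAbhyankarPlace V k K) (S : Finset Ω)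
    (hS : ∀ s ∈ S, s ∈ V ∧ s ∈ K) :
    ∃ (A : Subalgebra k Ω) (hAV : A.toSubring ≤ V.toSubring), (A : Set Ω) ⊆ K ∧
      (∀ s ∈ S, s ∈ A) ∧ A.FG ∧ (∀ z ∈ K, ∃ a ∈ A, ∃ b ∈ A, z = a / b) ∧
      IsRegularLocalRing (Localization.AtPrime (centre A V hAV)) := by
  classical
  have hkV' : ∀ c ∈ k, c ∈ V := fun c hc => hkV hc
  -- generators of `K|k` inside `O_V`
  obtain ⟨s₀, hs₀⟩ := id hfg
  obtain ⟨s₁, hs₁, hKs₁⟩ := exists_generators_mem_valuationSubring V k K s₀ hs₀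
  -- (1) the Abhyankar data and the defectless field `L = k(x, y)`
  obtain ⟨ρ, τ, x, y, hy, hxK, hyK, hxi, hri, halg, hdefL, hvalK⟩ :=
    exists_abhyankarData V k K hfg hkV hA
  set L : IntermediateField k Ω := IntermediateField.adjoin k (Set.range x ∪ Set.range y)
    with hLdef
  set E₀ : Subfield Ω := Subfield.closure ((k : Set Ω) ∪ (Set.range x ∪ Set.range y)) with hE₀
  have hLE₀ : ∀ z, z ∈ L ↔ z ∈ E₀ := fun z => mem_adjoin_subfield_iff k _ z
  have hLsub : L.toSubfield = E₀ := by
    ext z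
    exact hLE₀ z
  have hkE₀ : ∀ c ∈ k, c ∈ E₀ := fun c hc => Subfield.subset_closure (Or.inl hc)
  have hE₀K : E₀ ≤ K := by
    refine Subfield.closure_le.mpr ?_
    rintro z (hz | ⟨i, rfl⟩ | ⟨j, rfl⟩)
    exacts [hkK hz, (hxK i).1, hyK j]
  have hx0 : ∀ i, x i ≠ 0 := fun i => (hxK i).2
  set Lh : Subfield Ω := henselization V L.toSubfield with hLh
  have hE₀Lh : E₀ ≤ Lh := by
    rw [← hLsub]
    exact le_henselization V _
  -- (2) `K` as a finite extension `Kt` of `L`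
  set Kt : IntermediateField L.toSubfield Ω := IntermediateField.adjoin L.toSubfield (s₁ : Set Ω)
    with hKtdef
  have hKt : ∀ z, z ∈ Kt ↔ z ∈ K := by
    intro z
    rw [hKtdef, mem_adjoin_subfield_iff, hLsub]
    have heq : Subfield.closure ((E₀ : Set Ω) ∪ s₁) = K := by
      refine le_antisymm (Subfield.closure_le.mpr ?_) ?_
      · rintro t (ht | ht)
        exacts [hE₀K ht, (hs₁ t ht).2]
      · rw [← hKs₁]
        exact Subfield.closure_mono (Set.union_subset_union_left _ fun c hc => hkE₀ c hc)
    rw [heq]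
  haveI : FiniteDimensional L.toSubfield Kt :=
    IntermediateField.finiteDimensional_adjoin fun t ht => (halg t (hs₁ t ht).2).isIntegral
  have hE : valueSubgroup L.toSubfield (V.comap (algebraMap Kt Ω)) = ⊤ := by
    refine valueSubgroup_eq_top_of_forall_exists V fun a ha0 => ?_
    have ha0' : (a : Ω) ≠ 0 := fun h => ha0 (Subtype.ext h)
    obtain ⟨w, hwL, hw⟩ := hvalK (a : Ω) ((hKt _).mp a.2) ha0'
    exact ⟨⟨w, hwL⟩, hw⟩
  -- (3) the valuation basis `α` of `L^h·K` over `L^h`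
  obtain ⟨f, α, -, hαVK, hind, hspan⟩ := exists_valuation_basis V L.toSubfield Kt hdefL hE
  have hαV : ∀ i, α i ∈ V := fun i => (hαVK i).1
  have hαK : ∀ i, α i ∈ K := fun i => (hKt _).mp (hαVK i).2
  -- (4) `L^h`-expansions of finitely many elements of `O_V ∩ K`
  let T : Finset Ω := ({1} ∪ S ∪ s₁) ∪
    (Finset.univ : Finset (Fin f × Fin f)).image fun p => α p.1 * α p.2
  have h1T : (1 : Ω) ∈ T := by simp [T]
  have hST : ∀ s ∈ S, s ∈ T := fun s hs => by simp [T, hs]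
  have hs₁T : ∀ t ∈ s₁, t ∈ T := fun t ht => by simp [T, ht]
  have hαT : ∀ i j, α i * α j ∈ T := fun i j => by
    simp only [T, Finset.mem_union, Finset.mem_image, Finset.mem_univ, true_and, Prod.exists]
    exact Or.inr ⟨i, j, rfl⟩
  have hT : ∀ t ∈ T, t ∈ V ∧ t ∈ K := by
    intro t ht
    simp only [T, Finset.mem_union, Finset.mem_singleton, Finset.mem_image, Finset.mem_univ,
      true_and, Prod.exists] at ht
    rcases ht with ((rfl | ht) | ht) | ⟨i, j, rfl⟩
    · exact ⟨V.one_mem, K.one_mem⟩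
    · exact hS t ht
    · exact hs₁ t ht
    · exact ⟨mul_mem (hαV i) (hαV j), mul_mem (hαK i) (hαK j)⟩
  have hexp : ∀ t : T, ∃ c : Fin f → Ω, (∀ i, c i ∈ Lh ∧ c i ∈ V) ∧ (t : Ω) = ∑ i, c i * α i := by
    intro t
    obtain ⟨c, hc, ht⟩ := hspan t ((hKt _).mpr (hT t t.2).2)
    refine ⟨c, fun i => ⟨hc i, (V.valuation_le_one_iff _).mp ((hind c hc i).trans ?_)⟩, ht⟩
    rw [← ht]
    exact (V.valuation_le_one_iff _).mpr (hT t t.2).1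
  choose cT hcT hTeq using hexp
  let C : Finset Ω := Finset.univ.biUnion fun t : T => Finset.univ.image (cT t)
  have hcTC : ∀ (t : T) (i), cT t i ∈ C := fun t i => by
    simp only [C, Finset.mem_biUnion, Finset.mem_univ, true_and, Finset.mem_image]
    exact ⟨t, i, rfl⟩
  have hC : ∀ c ∈ C, c ∈ Lh ∧ c ∈ V := by
    intro c hc
    simp only [C, Finset.mem_biUnion, Finset.mem_univ, true_and, Finset.mem_image] at hc
    obtain ⟨t, i, rfl⟩ := hc
    exact hcT t i
  -- (5) a Hensel root `η` generating the coefficients over `L`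
  obtain ⟨η, hηV, hηLh, hCη, fη, hfmon, hfcoef, hfη, hfmin, hder⟩ :=
    exists_henselRoot_of_subset_henselization V L.toSubfield hdefL C fun c hc => (hC c hc).1
  have hfcoef' : ∀ i, fη.coeff i ∈ V ∧ fη.coeff i ∈ E₀ := fun i =>
    ⟨(hfcoef i).1, by rw [← hLsub]; exact (hfcoef i).2⟩
  have hfmin' : ∀ q : Polynomial Ω, (∀ i, q.coeff i ∈ E₀) → q ≠ 0 → q.eval η = 0 →
      fη.natDegree ≤ q.natDegree := fun q hq => hfmin q fun i => by rw [hLsub]; exact hq i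
  have hCE : ∀ c ∈ C, c ∈ V ∧ c ∈ Subfield.closure ((E₀ : Set Ω) ∪ {η}) := fun c hc =>
    ⟨(hC c hc).2, by rw [← hLsub]; exact hCη c hc⟩
  have hηLh' : Subfield.closure ((E₀ : Set Ω) ∪ {η}) ≤ Lh := by
    refine Subfield.closure_le.mpr ?_
    rintro z (hz | rfl)
    exacts [hE₀Lh hz, hηLh]
  -- (6) the standard-étale chart `A₁` and its regular local ring `D`
  obtain ⟨G, A₁, hA₁V, hG, hA₁F, hfpA₁, hsmA₁, hGA₁, hηA₁, hCA₁, hA₁le, hfA₁⟩ :=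
    exists_etaleChart V hkV' x y hx0 hxi hy hri hηV hfmon hfcoef' hfη hfmin' hder C hCE
  set D : Subalgebra k Ω := centreLocalRing V A₁ with hDdef
  haveI := hfpA₁
  haveI := hsmA₁
  have hDreg : IsRegularLocalRing D :=
    (isRegularLocalRing_centre_iff A₁ hA₁V).mp (isRegularLocalRing_of_isSmoothAt k A₁ (centre A₁ V hA₁V))
  have hDV : D.toSubring ≤ V.toSubring := centreLocalRing_le_valuationSubring hA₁V
  have hDloc : ∀ w ∈ D, V.valuation w = 1 → w⁻¹ ∈ D := fun w hw hw1 =>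
    inv_mem_centreLocalRing_of_valuation_eq_one hw hw1
  have hA₁D : A₁ ≤ D := le_centreLocalRing A₁
  have hA₁Lh : ∀ w ∈ A₁, w ∈ Lh := fun w hw => hηLh' (hA₁F hw)
  have hDLh : ∀ w ∈ D, w ∈ Lh := by
    rintro _ ⟨a, ha, b, hb, -, rfl⟩
    exact div_mem (hA₁Lh a ha) (hA₁Lh b hb)
  have hcTD : ∀ (t : T) (i), cT t i ∈ D := fun t i => hCA₁ _ (hcTC t i)
  -- (7) the regular local ring `B' = ⊕ D αᵢ`
  obtain ⟨B', hmemB', hB'V, hDB', hαB', hregB', hB'loc⟩ :=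
    exists_regular_valuativeSpan V hDV hDreg hDloc α hαV
      (fun i j => ⟨cT ⟨_, hαT i j⟩, hcTD _, hTeq ⟨_, hαT i j⟩⟩)
      ⟨cT ⟨1, h1T⟩, hcTD _, hTeq ⟨1, h1T⟩⟩
      (fun c hc j => hind c (fun i => hDLh _ (hc i)) j)
  have hTB' : ∀ t ∈ T, t ∈ B' := fun t ht => (hmemB' t).mpr ⟨cT ⟨t, ht⟩, hcTD _, hTeq ⟨t, ht⟩⟩
  have hA₁B' : A₁ ≤ B' := hA₁D.trans hDB'
  have hηB' : η ∈ B' := hA₁B' hηA₁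
  have hkB' : ∀ c ∈ k, c ∈ B' := fun c hc => B'.algebraMap_mem ⟨c, hc⟩
  have hKB' : K ≤ Subfield.closure (B' : Set Ω) := by
    rw [← hKs₁]
    refine Subfield.closure_le.mpr ?_
    rintro t (ht | ht)
    exacts [Subfield.subset_closure (hkB' t ht), Subfield.subset_closure (hTB' t (hs₁T t ht))]
  have hfracB' : ∀ z ∈ K, ∃ a ∈ B', ∃ b ∈ B', z = a / b := by
    intro z hz
    obtain ⟨a, ha, b, hb, rfl⟩ := (Subfield.mem_closure_iff).mp (hKB' hz)
    rw [show Subring.closure (B' : Set Ω) = B'.toSubring from Subring.closure_eq B'.toSubring]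
      at ha hb
    exact ⟨a, ha, b, hb, rfl⟩
  -- (8) the minimal polynomial `μ` of `η` over `K`: coefficients in `O_V ∩ K` and in `B'`
  set OK : ValuationSubring Kt := V.comap (algebraMap Kt Ω) with hOKdef
  letI algOK : Algebra OK Ω := ((algebraMap Kt Ω).comp (algebraMap OK Kt)).toAlgebra
  haveI : IsScalarTower OK Kt Ω := IsScalarTower.of_algebraMap_eq fun _ => rfl
  have hfK : ∀ i, fη.coeff i ∈ Kt.toSubfield := fun i => (hKt _).mpr (hE₀K (hfcoef' i).2)
  obtain ⟨fKt, hfKt, hfKtmon'⟩ := exists_polynomial_map_eq_of_coeff_mem_subfield Kt.toSubfield fη hfK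
  have hfKtmon : fKt.Monic := hfKtmon' hfmon
  have hfKtη : Polynomial.aeval η fKt = 0 := by
    rw [Polynomial.aeval_def, ← Polynomial.eval_map]
    change (fKt.map (algebraMap Kt.toSubfield Ω)).eval η = 0
    rw [hfKt]; exact hfη
  have hlifts : fKt ∈ Polynomial.lifts (algebraMap OK Kt) := by
    refine (Polynomial.lifts_iff_coeff_lifts fKt).mpr fun i => ?_
    have hi : ((fKt.coeff i : Kt) : Ω) = fη.coeff i := by
      rw [← hfKt, Polynomial.coeff_map]; rfl
    refine ⟨⟨fKt.coeff i, ?_⟩, rfl⟩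
    change ((fKt.coeff i : Kt) : Ω) ∈ V
    rw [hi]; exact (hfcoef i).1
  obtain ⟨fO, hfO, -, hfOmon⟩ := Polynomial.lifts_and_degree_eq_and_monic hlifts hfKtmon
  have hηint : IsIntegral OK η := by
    refine ⟨fO, hfOmon, ?_⟩
    rw [IsScalarTower.algebraMap_eq OK Kt Ω, ← Polynomial.eval₂_map, hfO, ← Polynomial.aeval_def]
    exact hfKtη
  have hηintK : IsIntegral Kt η := hηint.tower_top
  set μKt : Polynomial Kt := minpoly Kt η with hμKt
  have hμKteq : μKt = (minpoly OK η).map (algebraMap OK Kt) :=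
    minpoly.isIntegrallyClosed_eq_field_fractions' Kt hηint
  set μ : Polynomial Ω := μKt.map (algebraMap Kt Ω) with hμdef
  have hinjKt : Function.Injective (algebraMap Kt Ω) := (algebraMap Kt Ω).injective
  have hμmon : μ.Monic := (minpoly.monic hηintK).map _
  have hμη : μ.eval η = 0 := by
    rw [hμdef, Polynomial.eval_map, ← Polynomial.aeval_def]
    exact minpoly.aeval Kt η
  have hμcoef : ∀ i, μ.coeff i ∈ V ∧ μ.coeff i ∈ K := fun i => by
    rw [hμdef, Polynomial.coeff_map, hμKteq, Polynomial.coeff_map]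
    exact ⟨((minpoly OK η).coeff i).2, (hKt _).mp ((algebraMap OK Kt ((minpoly OK η).coeff i))).2⟩
  have hμdvd : μ ∣ fη := by
    rw [hμdef, ← hfKt]
    exact Polynomial.map_dvd (algebraMap Kt Ω) (minpoly.dvd Kt η hfKtη)
  have hμmin0 : ∀ q : Polynomial Ω, (∀ i, q.coeff i ∈ K) → q.eval η = 0 →
      q.natDegree < μ.natDegree → q = 0 := by
    intro q hqK hqη hqdeg
    obtain ⟨qKt, hqKt, -⟩ := exists_polynomial_map_eq_of_coeff_mem_subfield Kt.toSubfield q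
      fun i => (hKt _).mpr (hqK i)
    by_contra hq0
    have hqKt0 : qKt ≠ 0 := fun h => hq0 (by rw [← hqKt, h, Polynomial.map_zero])
    have hqKtη : Polynomial.aeval η qKt = 0 := by
      rw [Polynomial.aeval_def, ← Polynomial.eval_map]
      change (qKt.map (algebraMap Kt.toSubfield Ω)).eval η = 0
      rw [hqKt]; exact hqη
    have h1 : μKt.degree ≤ qKt.degree := minpoly.degree_le_of_ne_zero Kt η hqKt0 hqKtη
    have h2 : μKt.natDegree ≤ qKt.natDegree := Polynomial.natDegree_le_natDegree h1
    have h3 : μ.natDegree = μKt.natDegree := Polynomial.natDegree_map_eq_of_injective hinjKt _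
    have h4 : q.natDegree = qKt.natDegree := by
      rw [← hqKt]; exact Polynomial.natDegree_map_eq_of_injective hinjKt _
    rw [h3, h4] at hqdeg
    exact absurd h2 (not_le.mpr hqdeg)
  -- coefficients of `μ` lie in `B'` (integral over `A₁ ⊆ B'`, `B'` normal, `K ⊆ Frac B'`)
  haveI : IsRegularLocalRing B' := hregB'
  haveI : IsIntegrallyClosed B' := isIntegrallyClosed_of_isRegularLocalRing B'
  obtain ⟨fA, hfA, hfAmon'⟩ := exists_map_eq_of_coeff_mem A₁ fη hfA₁
  have hμB' : ∀ i, μ.coeff i ∈ B' := by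
    intro i
    have hintA : IsIntegral A₁ (μ.coeff i) :=
      Polynomial.isIntegral_coeff_of_dvd fA μ (hfAmon' hfmon) hμmon (by rw [hfA]; exact hμdvd) i
    letI : Algebra A₁ B' := (Subalgebra.inclusion hA₁B').toRingHom.toAlgebra
    haveI : IsScalarTower A₁ B' Ω := IsScalarTower.of_algebraMap_eq fun _ => rfl
    have hintB : IsIntegral B' (μ.coeff i) := hintA.tower_top
    obtain ⟨a, ha, b, hb, hab⟩ := hfracB' _ (hμcoef i).2
    by_cases hb0 : b = 0
    · rw [hab, hb0, div_zero]; exact B'.zero_mem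
    · exact mem_of_isIntegral_of_eq_div k B' ha hb hb0 hab hintB
  -- (9) the affine model `N` of `K`
  let GN : Finset Ω := (((G ∪ Finset.univ.image α) ∪ S) ∪ s₁) ∪ μ.coeffs
  set N : Subalgebra k Ω := Algebra.adjoin k (GN : Set Ω) with hNdef
  have hGN : ∀ w ∈ GN, w ∈ V ∧ w ∈ K ∧ w ∈ B' := by
    intro w hw
    simp only [GN, Finset.mem_union, Finset.mem_image, Finset.mem_univ, true_and] at hw
    rcases hw with (((hw | ⟨i, rfl⟩) | hw) | hw) | hw
    · exact ⟨(hG w hw).1, hE₀K (hG w hw).2, hA₁B' (hGA₁ w hw)⟩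
    · exact ⟨hαV i, hαK i, hαB' i⟩
    · exact ⟨(hS w hw).1, (hS w hw).2, hTB' w (hST w hw)⟩
    · exact ⟨(hs₁ w hw).1, (hs₁ w hw).2, hTB' w (hs₁T w hw)⟩
    · obtain ⟨i, -, rfl⟩ := Polynomial.mem_coeffs_iff.mp hw
      exact ⟨(hμcoef i).1, (hμcoef i).2, hμB' i⟩
  let VK : Subalgebra k Ω := { V.toSubring with algebraMap_mem' := fun c => hkV' c c.2 }
  let KK : Subalgebra k Ω := { K.toSubring with algebraMap_mem' := fun c => hkK c.2 }
  have hNV' : N ≤ VK := Algebra.adjoin_le fun w hw => (hGN w hw).1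
  have hNV : N.toSubring ≤ V.toSubring := fun w hw => hNV' hw
  have hNK' : N ≤ KK := Algebra.adjoin_le fun w hw => (hGN w hw).2.1
  have hNK : (N : Set Ω) ⊆ K := fun w hw => hNK' hw
  have hNB' : N ≤ B' := Algebra.adjoin_le fun w hw => (hGN w hw).2.2
  have hNfg : N.FG := ⟨GN, rfl⟩
  have hGNN : ∀ w ∈ GN, w ∈ N := fun w hw => Algebra.subset_adjoin hw
  have hSN : ∀ s ∈ S, s ∈ N := fun s hs => hGNN s (by simp [GN, hs])
  have hs₁N : ∀ t ∈ s₁, t ∈ N := fun t ht => hGNN t (by simp [GN, ht])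
  have hGN' : ∀ g ∈ G, g ∈ N := fun g hg => hGNN g (by simp [GN, hg])
  have hαN : ∀ i, α i ∈ N := fun i => hGNN _ (by simp [GN])
  have hμN : ∀ i, μ.coeff i ∈ N := fun i => by
    by_cases h0 : μ.coeff i = 0
    · rw [h0]; exact N.zero_mem
    · exact hGNN _ (by simp [GN, Polynomial.coeff_mem_coeffs h0])
  have hkN : ∀ c ∈ k, c ∈ N := fun c hc => N.algebraMap_mem ⟨c, hc⟩
  -- `Frac N = K`
  have hKN : K ≤ Subfield.closure (N : Set Ω) := by
    rw [← hKs₁]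
    refine Subfield.closure_le.mpr ?_
    rintro t (ht | ht)
    exacts [Subfield.subset_closure (hkN t ht), Subfield.subset_closure (hs₁N t ht)]
  have hfracN : ∀ z ∈ K, ∃ a ∈ N, ∃ b ∈ N, z = a / b := by
    intro z hz
    obtain ⟨a, ha, b, hb, rfl⟩ := (Subfield.mem_closure_iff).mp (hKN hz)
    rw [show Subring.closure (N : Set Ω) = N.toSubring from Subring.closure_eq N.toSubring]
      at ha hb
    exact ⟨a, ha, b, hb, rfl⟩
  -- minimality of `μ` over the local ring of `N`
  have hμmin : ∀ q : Polynomial Ω, (∀ i, q.coeff i ∈ centreLocalRing V N) → q.eval η = 0 →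
      q.natDegree < μ.natDegree → q = 0 := by
    have hCK : ∀ w ∈ centreLocalRing V N, w ∈ K := by
      rintro _ ⟨a, ha, b, hb, -, rfl⟩
      exact div_mem (hNK ha) (hNK hb)
    exact fun q hq => hμmin0 q fun i => hCK _ (hq i)
  -- `B' ⊆ (N[η])_q`
  have hB'le : B' ≤ centreLocalRing V (Algebra.adjoin k ((N : Set Ω) ∪ {η})) := by
    set Tg : Subalgebra k Ω := centreLocalRing V (Algebra.adjoin k ((N : Set Ω) ∪ {η})) with hTg
    have hmono : Algebra.adjoin k ((G : Set Ω) ∪ {η}) ≤ Algebra.adjoin k ((N : Set Ω) ∪ {η}) :=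
      Algebra.adjoin_mono (Set.union_subset_union_left _ fun g hg => hGN' g hg)
    have hA₁Tg : A₁ ≤ Tg := hA₁le.trans (centreLocalRing_mono hmono)
    have hDTg : D ≤ Tg := by
      rintro _ ⟨a, ha, b, hb, hb1, rfl⟩
      rw [div_eq_mul_inv]
      exact Tg.mul_mem (hA₁Tg ha) (inv_mem_centreLocalRing_of_valuation_eq_one (hA₁Tg hb) hb1)
    have hαTg : ∀ i, α i ∈ Tg := fun i =>
      le_centreLocalRing _ (Algebra.subset_adjoin (Or.inl (hαN i)))
    intro w hw
    obtain ⟨c, hc, rfl⟩ := (hmemB' w).mp hw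
    exact Tg.sum_mem fun i _ => Tg.mul_mem (hDTg (hc i)) (hαTg i)
  -- (10) conclusion: `N_q` is regular by flat descent from `B'`
  refine ⟨N, hNV, hNK, hSN, hNfg, hfracN, ?_⟩
  exact isRegularLocalRing_centre_of_descent V N hNfg hNV hηV μ hμmon hμN hμη hμmin B' hregB'
    hB'V hB'loc hNB' hηB' hB'le

end Main

/-! ## Transport along a field embedding, and the typed statement -/

section Transport

variable {Ω Ω' : Type*} [Field Ω] [Field Ω'] (ι : Ω →+* Ω')

/-- **Abhyankar places are transported along field embeddings**: if `ι⁻¹(V') = V` then an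
Abhyankar place `(F|K, V)` gives the Abhyankar place `(ι(F)|ι(K), V')` (same `x, y`: values,
residues and algebraicity are transported by `SubfieldTransport.lean`). [folklore] -/
theorem isAbhyankarPlace_map {V : ValuationSubring Ω} {V' : ValuationSubring Ω'}
    (hV : V'.comap ι = V) {K F : Subfield Ω} (h : IsAbhyankarPlace V K F) :
    IsAbhyankarPlace V' (K.map ι) (F.map ι) := by
  classical
  obtain ⟨ρ, τ, x, y, hy, hxF, hyF, hxi, hri, halg⟩ := h
  have hmemV' : ∀ a : Ω, ι a ∈ V' ↔ a ∈ V := fun a => by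
    rw [← ValuationSubring.mem_comap, hV]
  have hy' : ∀ j, ι (y j) ∈ V' := fun j => (hmemV' _).mpr (hy j)
  -- the residue map `κ(V) → κ(V')`
  let φ : V →+* V' :=
    { toFun := fun a => ⟨ι (a : Ω), (hmemV' _).mpr a.2⟩
      map_one' := Subtype.ext (map_one ι)
      map_mul' := fun a b => Subtype.ext (map_mul ι (a : Ω) (b : Ω))
      map_zero' := Subtype.ext (map_zero ι)
      map_add' := fun a b => Subtype.ext (map_add ι (a : Ω) (b : Ω)) }
  haveI : IsLocalHom φ := by
    refine ⟨fun a ha => ?_⟩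
    rw [ValuationSubring.valuation_eq_one_iff] at ha ⊢
    change V'.valuation (ι a) = 1 at ha
    exact (valuation_map_eq_one_iff ι hV a).mp ha
  let g : ResidueField V →+* ResidueField V' := IsLocalRing.ResidueField.map φ
  have hg : ∀ a : V, g (residue V a) = residue V' (φ a) := fun a =>
    IsLocalRing.ResidueField.map_residue φ a
  have hgK : ∀ r ∈ resField V K, g r ∈ resField V' (K.map ι) := by
    intro r hr
    obtain ⟨a, haK, rfl⟩ := (mem_resField_iff V K r).mp hr
    rw [hg]
    exact residue_mem_resField V' (φ a) (Subfield.mem_map.mpr ⟨a, haK, rfl⟩)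
  let f : resField V K →+* resField V' (K.map ι) :=
    (g.comp (resField V K).subtype).codRestrict _ fun r => hgK r r.2
  have hfs : Function.Surjective f := by
    intro r'
    obtain ⟨a', ha'K, ha'⟩ := (mem_resField_iff V' (K.map ι) r').mp r'.2
    obtain ⟨a, haK, haa'⟩ := Subfield.mem_map.mp ha'K
    have haV : a ∈ V := (hmemV' a).mp (haa' ▸ a'.2)
    refine ⟨⟨residue V ⟨a, haV⟩, residue_mem_resField V ⟨a, haV⟩ haK⟩, Subtype.ext ?_⟩
    change g (residue V ⟨a, haV⟩) = r'
    rw [hg, ← ha']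
    congr 1
    exact Subtype.ext haa'
  have hcomp : (algebraMap (resField V' (K.map ι)) (ResidueField V')).comp f =
      g.comp (algebraMap (resField V K) (ResidueField V)) := RingHom.ext fun _ => rfl
  have hri' : AlgebraicIndependent (resField V' (K.map ι))
      (fun j => residue V' ⟨ι (y j), hy' j⟩) := by
    have h1 := hri.ringHom_of_comp_eq f g hfs g.injective hcomp
    have h2 : (⇑g ∘ fun j => residue V ⟨y j, hy j⟩) = fun j => residue V' ⟨ι (y j), hy' j⟩ := by
      funext j
      simp only [Function.comp_apply]
      rw [hg]
      rfl
    rwa [h2] at h1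
  -- the data in `Ω'`
  have hset : Set.range (fun i => ι (x i)) ∪ Set.range (fun j => ι (y j)) =
      ι '' (Set.range x ∪ Set.range y) := by
    rw [Set.image_union, ← Set.range_comp, ← Set.range_comp]
    rfl
  refine ⟨ρ, τ, fun i => ι (x i), fun j => ι (y j), hy', fun i => ?_, fun j => ?_, ?_, hri', ?_⟩
  · exact ⟨Subfield.mem_map.mpr ⟨x i, (hxF i).1, rfl⟩, (map_ne_zero ι).mpr (hxF i).2⟩
  · exact Subfield.mem_map.mpr ⟨y j, hyF j, rfl⟩
  · rintro m ⟨b', hb'K, hb'⟩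
    obtain ⟨b, hbK, rfl⟩ := Subfield.mem_map.mp hb'K
    refine hxi m ⟨b, hbK, ?_⟩
    have hprod : (∏ i, V'.valuation (ι (x i)) ^ m i) = V'.valuation (ι (∏ i, x i ^ m i)) := by
      rw [map_prod, map_prod]
      simp_rw [map_zpow₀]
    rw [hprod, valuation_map_eq_iff ι hV] at hb'
    rw [← hb', map_prod]
    simp_rw [map_zpow₀]
  · intro z' hz'
    obtain ⟨z, hzF, rfl⟩ := Subfield.mem_map.mp hz'
    rw [hset]
    exact (isAlgebraic_adjoin_map_iff ι K _ z).mpr (halg z hzF)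

end Transport

/-! ## The typed statement -/

section Typed

/-- **Cutkosky 2022, Theorem 1.3** (local uniformization of Abhyankar places in arbitrary
characteristic, affine-model form) HOLDS: the named fact `Cutkosky2022_Thm13` of
`LocalUniformizationAbhyankarPlaces.lean` is a theorem. PROVED: embed `K` in an algebraic
closure `Ω`, extend `O` to `V ≤ Ω` (`exists_valuationSubring_comap_eq`), transport the
hypotheses (`isAbhyankarPlace_map`, `fgOver_map`), apply
`exists_regular_model_of_isAbhyankarPlace`, and pull the model back along `K → Ω`.
[cite: Cutkosky2022, Thm. 1.3] -/
theorem Cutkosky2022_Thm13_holds : Cutkosky2022_Thm13.{u} := by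
  intro k K _ _ _ hKfg O hO hAbh S hSfg hSO
  classical
  let Ω : Type u := AlgebraicClosure K
  obtain ⟨V, hV⟩ := exists_valuationSubring_comap_eq (Ω := Ω) O
  let ι : K →+* Ω := algebraMap K Ω
  let ιa : K →ₐ[k] Ω := IsScalarTower.toAlgHom k K Ω
  have hιa : ∀ z, ιa z = ι z := fun _ => rfl
  set K₀ : Subfield K := (algebraMap k K).fieldRange with hK₀
  have hK₀O : (K₀ : Set K) ⊆ O := by
    rintro _ ⟨c, rfl⟩
    exact hO c
  have hfg₀ : FGOver K₀ (⊤ : Subfield K) := by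
    obtain ⟨s, hs⟩ := hKfg
    refine ⟨s, ?_⟩
    have h1 : (IntermediateField.adjoin k (s : Set K)).toSubfield =
        Subfield.closure (Set.range (algebraMap k K) ∪ (s : Set K)) := rfl
    rw [RingHom.coe_fieldRange, ← h1, hs]
    rfl
  -- the data in `Ω`
  set kΩ : Subfield Ω := K₀.map ι with hkΩ
  set KΩ : Subfield Ω := (⊤ : Subfield K).map ι with hKΩ
  have hmemV : ∀ z : K, ι z ∈ V ↔ z ∈ O := fun z => by
    rw [← ValuationSubring.mem_comap, hV]
  have hkK : kΩ ≤ KΩ := fun _ ⟨a, _, ha⟩ => ⟨a, trivial, ha⟩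
  have hfg : FGOver kΩ KΩ := fgOver_map ι hfg₀
  have hkV : (kΩ : Set Ω) ⊆ V := by
    rintro _ ⟨a, haK₀, rfl⟩
    exact (hmemV a).mpr (hK₀O haK₀)
  have hA : IsAbhyankarPlace V kΩ KΩ := isAbhyankarPlace_map ι hV hAbh
  obtain ⟨t, ht⟩ := hSfg
  have htS : (t : Set K) ⊆ S := ht ▸ Algebra.subset_adjoin
  have htΩ : ∀ s ∈ t.image ι, s ∈ V ∧ s ∈ KΩ := by
    intro s hs
    obtain ⟨z, hz, rfl⟩ := Finset.mem_image.mp hs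
    exact ⟨(hmemV z).mpr (hSO (htS hz)), ⟨z, trivial, rfl⟩⟩
  -- the regular model in `Ω`
  obtain ⟨A, hAV, hAK, htA, hAfg, hfrac, hreg⟩ :=
    exists_regular_model_of_isAbhyankarPlace V kΩ KΩ hkK hfg hkV hA (t.image ι) htΩ
  -- pulled back to `K`
  let B : Subalgebra k K :=
    { A.toSubring.comap ι with
      algebraMap_mem' := fun c => by
        change ι (algebraMap k K c) ∈ A
        exact A.algebraMap_mem ⟨ι (algebraMap k K c), algebraMap k K c, ⟨c, rfl⟩, rfl⟩ }
  have hmemB : ∀ z : K, z ∈ B ↔ ι z ∈ A := fun z => Iff.rfl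
  have hAι : ∀ w ∈ A, ∃ z : K, ι z = w := fun w hw => by
    obtain ⟨z, -, rfl⟩ := Subfield.mem_map.mp (hAK hw)
    exact ⟨z, rfl⟩
  have hBO : B.toSubring ≤ O.toSubring := fun z hz => (hmemV z).mp (hAV ((hmemB z).mp hz))
  refine ⟨B, hBO, ?_, ?_, ?_, ?_⟩
  · -- `S ≤ B`
    rw [← ht]
    refine Algebra.adjoin_le fun z hz => (hmemB z).mpr (htA _ ?_)
    exact Finset.mem_image.mpr ⟨z, hz, rfl⟩
  · -- `B` is finitely generated
    obtain ⟨t₂, ht₂⟩ := hAfg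
    have ht₂A : (t₂ : Set Ω) ⊆ A := ht₂ ▸ Algebra.subset_adjoin
    have hinj : Set.InjOn ι (ι ⁻¹' (t₂ : Set Ω)) := fun a _ b _ h => ι.injective h
    let t₃ : Finset K := t₂.preimage ι hinj
    have ht₃ : ι '' (t₃ : Set K) = t₂ := by
      rw [Finset.coe_preimage]
      refine Set.image_preimage_eq_of_subset fun w hw => ?_
      obtain ⟨z, hz⟩ := hAι w (ht₂A hw)
      exact ⟨z, hz⟩
    refine ⟨t₃, le_antisymm (Algebra.adjoin_le fun z hz => ?_) fun z hz => ?_⟩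
    · rw [Finset.mem_coe, Finset.mem_preimage] at hz
      exact (hmemB z).mpr (ht₂A hz)
    · -- `ι z ∈ k[t₂] = ι(k[t₃])`
      let T : Subalgebra kΩ Ω :=
        { (Algebra.adjoin k (t₂ : Set Ω)).toSubring.toSubsemiring with
          algebraMap_mem' := fun c => by
            obtain ⟨a, ⟨c', rfl⟩, hac⟩ := Subfield.mem_map.mp c.2
            change (c : Ω) ∈ Algebra.adjoin k (t₂ : Set Ω)
            rw [← hac]
            exact (Algebra.adjoin k (t₂ : Set Ω)).algebraMap_mem c' }
      have hAT : A ≤ T := by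
        rw [← ht₂]
        exact Algebra.adjoin_le fun w hw => (Algebra.subset_adjoin hw : w ∈ Algebra.adjoin k _)
      have h1 : ι z ∈ Algebra.adjoin k (t₂ : Set Ω) := hAT ((hmemB z).mp hz)
      have himg : (ιa : K → Ω) '' (t₃ : Set K) = (t₂ : Set Ω) := by rw [← ht₃]; rfl
      have h2 : (Algebra.adjoin k (t₃ : Set K)).map ιa = Algebra.adjoin k (t₂ : Set Ω) := by
        rw [AlgHom.map_adjoin, himg]
      rw [← h2, Subalgebra.mem_map] at h1
      obtain ⟨z', hz', hzz'⟩ := h1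
      rw [hιa] at hzz'
      rwa [← ι.injective hzz']
  · -- `Frac B = K`
    refine isFractionRing_of_forall_exists_div B.toSubring fun z => ?_
    obtain ⟨a', ha', b', hb', hab⟩ := hfrac (ι z) ⟨z, trivial, rfl⟩
    obtain ⟨a, rfl⟩ := hAι a' ha'
    obtain ⟨b, rfl⟩ := hAι b' hb'
    refine ⟨a, (hmemB a).mpr ha', b, (hmemB b).mpr hb', ι.injective ?_⟩
    rw [hab, map_div₀]
  · -- regular at the centre
    let e₀ : B →+* A :=
      { toFun := fun z => ⟨ι (z : K), (hmemB z).mp z.2⟩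
        map_one' := Subtype.ext (map_one ι)
        map_mul' := fun a b => Subtype.ext (map_mul ι (a : K) (b : K))
        map_zero' := Subtype.ext (map_zero ι)
        map_add' := fun a b => Subtype.ext (map_add ι (a : K) (b : K)) }
    have he₀ : Function.Bijective e₀ := by
      refine ⟨fun a b h => Subtype.ext (ι.injective (congrArg Subtype.val h)), fun w => ?_⟩
      obtain ⟨z, hz⟩ := hAι w w.2
      exact ⟨⟨z, (hmemB z).mpr (hz ▸ w.2)⟩, Subtype.ext hz⟩
    let e : B ≃+* A := RingEquiv.ofBijective e₀ he₀
    have he : ∀ z : B, ((e z : A) : Ω) = ι z := fun _ => rfl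
    change IsRegularLocalRing (Localization.AtPrime (centre B O hBO))
    have hPQ : centre B O hBO = (centre A V hAV).comap e.toRingHom := by
      ext z
      rw [Ideal.mem_comap, mem_centre_iff, mem_centre_iff]
      change O.valuation (z : K) < 1 ↔ V.valuation ((e z : A) : Ω) < 1
      rw [he, valuation_map_lt_one_iff ι hV]
    have hmap := primeCompl_map_ringEquiv e (centre B O hBO) (centre A V hAV) hPQ
    let eL : Localization.AtPrime (centre B O hBO) ≃+* Localization.AtPrime (centre A V hAV) :=
      IsLocalization.ringEquivOfRingEquiv (Localization.AtPrime (centre B O hBO))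
        (Localization.AtPrime (centre A V hAV)) e hmap
    exact @IsRegularLocalRing.of_ringEquiv (Localization.AtPrime (centre A V hAV)) _ hreg
      (Localization.AtPrime (centre B O hBO)) _ eL.symm

end Typed








end Literature.AlgebraicGeometry.Resolution

end
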